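import Mathlib.Analysis.Calculus.Deriv.Basic
import Mathlib.Analysis.SpecialFunctions.Log.Basic
import Mathlib.Analysis.Convex.Function
import Mathlib.Analysis.Convex.SpecificFunctions.Basic
import Mathlib.Data.ZMod.Basic
import Mathlib.Topology.Algebra.InfiniteSum.Basic
import Mathlib.Algebra.BigOperators.Finprod
import Mathlib.NumberTheory.Padics.PadicNorm
import Mathlib.Topology.UniformSpace.UniformConvergenceTopology
import Mathlib.Data.ENat.Basic
import Mathlib.Analysis.Calculus.Deriv.Add
import Mathlib.Analysis.Calculus.Deriv.Mul
import Mathlib.Analysis.Calculus.Deriv.Comp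
import Mathlib.Analysis.Calculus.Deriv.Inv
import Mathlib.Data.Int.Log
import Mathlib.Algebra.BigOperators.Intervals
import HarnessLib

/-!
# The scaling site of Connes–Consani (2016–2017): the periodic orbits `C_p = ℝ₊*/p^ℤ`, their
# divisors, Jacobian and theta functions — statement layer

Topic `Literature/NumberTheory/ConnesConsani`. STATEMENT LEVEL: definitions with bodies and NAMED
FACTS (`def … : Prop`, no proof claimed), with locators. Sources: A. Connes, C. Consani, *The scaling
site*, C. R. Math. 354 (2016) 1–6 [bib `ConnesConsani2016ScalingSiteCRAS`] (announcement) and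
*Geometry of the scaling site*, Selecta Math. (N.S.) 23 (2017) 1803–1850 = arXiv:1603.03191
[bib `ConnesConsani2017ScalingSite`]; numbering is that of the Selecta paper.

## The objects, in the authors' words (what is typed, what is not)

* **§2–§4, the scaling site.** `𝒮 = ([0, ∞) ⋊ ℕ^×, 𝒪)`: "the topos of `ℕ^×`-equivariant sheaves (of
  sets) on the half-line" with (§4) "the structure sheaf `𝒪` … of semirings `𝒪(U)` of continuous
  convex functions `f(λ) ∈ ℝ_max`, such that for any `λ ∈ U` there exists an open interval `V`
  containing `λ`, with `f` affine and with slope `f' ∈ ℤ` in the complement `V ∖ {λ}`", `ℕ^×` acting by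
  `f ↦ f(n·)` (eq. (25)); **Definition 4.1** "The scaling site `𝒮` is the semi-ringed topos given by
  the topos `[0,∞) ⋊ ℕ^×` endowed with the structure sheaf `𝒪`." **Theorem 3.9/1st Thm of §1**: "The
  space of points of the topos `[0, ∞) ⋊ ℕ^×` is canonically isomorphic to `𝒜(ℝ₊^max) ≃
  ℚ^× \ 𝔸_ℚ/Ẑ*`" (the map `Θ`); **Theorem 4.2** (stalks: germs `ℛ_H` of piecewise affine convex
  functions with slopes in `H`, resp. `𝒵_H`); **Theorem 4.3** (points of `𝒮` over `ℝ₊^max` = points of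
  the topos); **Definition 4.6** "the order of `f` at `H` is defined as `Ord(f) = h₊ - h₋ ∈ H ⊂ ℝ`,
  where `h_± = lim_{ε→0±} (f((1+ε)H) - f(H))/ε`". NOT TYPED: the topos, sheaves and stalks (no
  Grothendieck-topos points in Mathlib); TYPED: the order (`cpOrder`, via one-sided derivatives).
* **§5, the periodic orbits.** "Let `p` be a prime and consider the subspace `C_p` of points of
  `[0, ∞) ⋊ ℕ^×` corresponding to subgroups `H ⊂ ℝ` which are abstractly isomorphic to the subgroup
  `H_p ⊂ ℚ` of fractions with denominator a power of `p`." **Lemma 5.1**: "(i) The map `ℝ₊* → C_p`,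
  `λ ↦ λH_p` induces the isomorphism `η_p : ℝ₊*/p^ℤ → C_p`. (ii) The pull-back by `η_p` of the […]
  structure sheaf `𝒪` is the sheaf `𝒪_p` on `ℝ₊*/p^ℤ` of piecewise affine (continuous), convex
  functions with slopes in `H_p`." **Prop. 5.2 (i)** `𝒦_p` = "piecewise affine, continuous functions
  with slopes in `H_p`, endowed with the two operations max, +"; (ii) Cartier divisors `𝒦_p*/𝒪_p*` =
  naive divisors `H ↦ D(H) ∈ H` with locally finite support. **Def. 5.3** divisors `Div(C_p)`:
  "the maps `H ∈ C_p ↦ D(H) ∈ H` with finite support"; "The sheaf `𝒦_p` has global sections and they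
  form the semifield `𝒦(C_p)`" = (proof of Prop. 5.4 (v)) "a real valued function `f : ℝ₊* → ℝ` which
  is piecewise affine, continuous, with slopes in `H_p` and fulfills `f(pλ) = f(λ)`". **Prop. 5.4**:
  `Div(C_p)` is an ordered abelian group, `deg(D) := Σ_H D(H) ∈ ℝ` is a surjective homomorphism,
  `(f) := Σ_H (H, ord_H f)` is a homomorphism `𝒦^×(C_p) → Div(C_p)`, and "`Σ_H ord_H(f) = 0`".
  **Prop. 5.5**: `χ(a/p^n) := a mod (p-1)`, `χ_H := χ ∘ λ⁻¹` for `H = λH_p`, `χ(D) := Σ_H χ_H(D(H))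
  ∈ ℤ/(p-1)ℤ` kills principal divisors. **Theorem 5.6**: "The map … `(deg, χ) : Div(C_p)/𝒫 → ℝ ×
  (ℤ/(p-1)ℤ)` is an isomorphism of abelian groups." TYPED: `IsPFraction` (`H_p`), `IsCpRational`
  (`𝒦(C_p)`), `IsCpRegularAt` (local sections of `𝒪_p`: convexity), `cpOrder`, `CpDivisor`, `cpDeg`,
  `pFractionChi`/`cpChi`, `CpDivisor.IsPrincipal`, named fact `ConnesConsani2017_thm_5_6`.
* **§5.3 theta functions.** `f₊(λ) := Σ_{m≥0} (0 ∨ (1 - p^m λ))`, `f₋(λ) := Σ_{m≥1} (0 ∨ (p^{-m}λ - 1))`,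
  "**Lemma 5.10** (ii) The function `θ(λ) := f₊(λ) + f₋(λ)` … is convex (continuous), piecewise affine
  with slopes in `H_p` and fulfills the equation: `θ(pλ) = θ(λ) + λ - 1`, `∀λ ∈ (0, ∞)`. (iii) One has
  `|θ(λ) - (λ/(p-1) - log λ/log p)| ≤ 1` `∀λ ∈ (0, ∞)`." TYPED: `cpTheta`, named fact
  `ConnesConsani2017_lemma_5_10`. Theorem 5.12 (every `f ∈ 𝒦(C_p)` is `Σ_i Θ_{h_i,μ_i} - Σ_j
  Θ_{h'_j,μ'_j} - hλ + c`) is not typed.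
* **§5.4 Riemann–Roch of type II.** `H⁰(D) := {f ∈ 𝒦(C_p) | D + (f) ≥ 0}` (eq. (43); TYPED:
  `cpH0`), with the convention that the constant `-∞` belongs to every `H⁰(D)` and "`H⁰(D) = 0`" means
  no other element; **Lemma 5.13** "(i) If `deg(D) < 0` then `H⁰(D) = 0`. (ii) If `deg(D) > 0` then
  `H⁰(D) ≠ 0`." (TYPED: named fact `ConnesConsani2017_lemma_5_13`). **Def. 5.14** `‖f‖_p := max
  {|h(λ)|_p/λ}` (p-adic size of the slopes), **Prop. 5.15 (v)** the filtration `H⁰(D)^ρ := {‖f‖_p ≤ ρ}`,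
  **Def. 5.16** the Lebesgue covering dimension `dim_top`, `Dim_ℝ(H⁰(D)) := lim_{n→∞} p^{-n}
  dim_top(H⁰(D)^{p^n})` (eq. (47), topology of uniform convergence on `[1, p]`), and **Theorem 5.17**:
  "(i) Let `D ∈ Div(C_p)` be a divisor with `deg(D) ≥ 0`. Then the limit in (47) converges and one has
  `Dim_ℝ(H⁰(D)) = deg(D)`. (ii) The Riemann–Roch formula holds
  `Dim_ℝ(H⁰(D)) - Dim_ℝ(H⁰(-D)) = deg(D)` `∀D ∈ Div(C_p)`." TYPED (appended 2026-08-19): `pFractionPadicNorm`,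
  `cpSlopeNorm` (Def. 5.14), `CpH0Level` with the uniform-convergence topology (Prop. 5.15 (v), eq. (46)),
  a local Lebesgue covering dimension `coveringDim` (Def. 5.16; Mathlib has none), `cpDimSeq` (eq. (47)) and
  the named fact `ConnesConsani2017_thm_5_17`.
  For the record (§1): compared with a tropical elliptic curve `ℝ/Lℤ` (where
  `0 → ℝ/Lℤ → Div/𝒫 → ℤ → 0`), "for the periodic orbit `C_p` the group of divisor classes is
  `Div(C_p)/𝒫 ≃ ℝ × (ℤ/(p-1)ℤ)`. The second fundamental difference is the appearance of continuous
  dimensions in our Riemann–Roch theorem."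

## Design
Points of `C_p` are parametrised by `λ ∈ ℝ₊*` modulo `p^ℤ` (Lemma 5.1 (i)); all functions are
`ℝ → ℝ` used on `(0, ∞)` only. A divisor is a function `λ ↦ D(λ)` with `D(pλ) = D(λ)` (same point),
`D(λ) ∈ λH_p` (i.e. `D(H) ∈ H = λH_p`) and finite support in the fundamental domain `[1, p)`; `deg`
and `χ` are sums over that fundamental domain (`finsum`). `χ` on `H_p` is read off a representation
`x = a/p^n` chosen by `Classical.choose`; it is independent of the choice since `p ≡ 1 (mod p-1)`
(Prop. 5.5; PROVED below, `pFractionChi_eq`, appended 2026-08-19 together with the piecewise-affine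
calculus of `𝒦(C_p)`, Prop. 5.4 (v) `IsCpRational.finsum_cpOrder_eq_zero`, Prop. 5.5 (ii)
`IsCpRational.finsum_chi_cpOrder_eq_zero`, the inclusion `𝒫 ⊆ Ker(deg, χ)` of Thm. 5.6 and
Lemma 5.13 (i) `cpH0_eq_empty_of_cpDeg_neg`; then the constructive half of Thm. 5.6 — the periodic
piecewise-affine function with prescribed divisor, `CpDivisor.isPrincipal_of_cpDeg_eq_zero_of_cpChi_eq_zero`,
point divisors `CpDivisor.single` and the surjectivity of `(deg, χ)` — and Lemma 5.13 (ii)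
`cpH0_nonempty_of_cpDeg_pos`, so that the named facts `ConnesConsani2017_thm_5_6` and
`ConnesConsani2017_lemma_5_13` are DISCHARGED by `ConnesConsani2017_thm_5_6_holds` and
`ConnesConsani2017_lemma_5_13_holds`). The semifield structure (`max`, `+`) of `𝒦(C_p)` is that
of real functions. `p` is any natural number in the definitions; the facts assume `p` prime.
-/

noncomputable section

open Set Filter
open scoped Topology

namespace Literature.NumberTheory.ConnesConsani

/-! ## `H_p`, rational functions on `C_p`, order, divisors -/

/-- `x ∈ H_p ⊂ ℚ ⊂ ℝ`: "the subgroup `H_p ⊂ ℚ` of fractions with denominator a power of `p`".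
[cite: ConnesConsani2017ScalingSite, §5 (first paragraph)] -/
def IsPFraction (p : ℕ) (x : ℝ) : Prop :=
  ∃ (a : ℤ) (n : ℕ), x = (a : ℝ) / (p : ℝ) ^ n

/-- `0 ∈ H_p`. [folklore] -/
theorem isPFraction_zero (p : ℕ) : IsPFraction p 0 := ⟨0, 0, by simp⟩

/-- Integers belong to `H_p`. [folklore] -/
theorem isPFraction_intCast (p : ℕ) (a : ℤ) : IsPFraction p a := ⟨a, 0, by simp⟩

/-- **Global rational functions `𝒦(C_p)`** (Prop. 5.2 (i), Def. 5.3 and the proof of Prop. 5.4 (v)):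
"a real valued function `f : ℝ₊* → ℝ` which is piecewise affine, continuous, with slopes in `H_p`
and fulfills `f(pλ) = f(λ)` `∀λ ∈ ℝ₊*`. Such a function is uniquely determined by its restriction to
the fundamental domain `[λ₀, pλ₀]` […] Let `λ₀ < λ₁ < … < λ_{n-1} < λ_n = pλ₀` be a finite sequence of
positive real numbers such that `f` is affine with slope `h_j ∈ H_p` on the interval
`I_j = [λ_{j-1}, λ_j]`." Rendered literally: periodicity on `(0, ∞)` and affine pieces with slopes in
`H_p` on consecutive intervals of one period (continuity follows). [cite: ConnesConsani2017ScalingSite, Prop. 5.2 (i), Def. 5.3, proof of Prop. 5.4 (v)] -/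
def IsCpRational (p : ℕ) (f : ℝ → ℝ) : Prop :=
  (∀ x : ℝ, 0 < x → f (p * x) = f x) ∧
    ∃ (n : ℕ) (lam : Fin (n + 2) → ℝ) (h : Fin (n + 1) → ℝ),
      0 < lam 0 ∧ StrictMono lam ∧ lam (Fin.last (n + 1)) = p * lam 0 ∧
        (∀ j, IsPFraction p (h j)) ∧
          ∀ (j : Fin (n + 1)) (x : ℝ), lam j.castSucc ≤ x → x ≤ lam j.succ →
            f x = f (lam j.castSucc) + h j * (x - lam j.castSucc)

/-- Local sections of the structure sheaf `𝒪_p` near `λ` are moreover CONVEX: "piecewise affine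
(continuous), convex functions with slopes in `H_p`" (Lemma 5.1 (ii)); at a break point this is
`∂⁺f(λ) ≥ ∂⁻f(λ)` (proof of Lemma 5.1 (ii): "`λ∂⁺_λ g(λ) ≥ λ∂⁻_λ g(λ)`"). We record the pointwise
condition through one-sided derivatives. [cite: ConnesConsani2017ScalingSite, Lemma 5.1 (ii)] -/
def IsCpRegularAt (f : ℝ → ℝ) (x : ℝ) : Prop :=
  derivWithin f (Iio x) x ≤ derivWithin f (Ioi x) x

/-- **The order of `f` at the point `λH_p`** (Definition 4.6: "`Ord(f) = h₊ - h₋ ∈ H ⊂ ℝ`, where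
`h_± = lim_{ε→0±} (f((1+ε)H) - f(H))/ε`"; in the coordinate `λ`, `h_± = λ ∂^±f(λ)`, so
`Order(f)(λ) = λ(∂⁺f(λ) - ∂⁻f(λ)) ∈ λH_p`, cf. proof of Prop. 5.4 (v): "`Order(f)(λ_i) = λ_i(h_{i+1} -
h_i)`"). One-sided derivatives as `derivWithin` on `Ioi`/`Iio`. [cite: ConnesConsani2017ScalingSite, Def. 4.6 and proof of Prop. 5.4 (v)] -/
def cpOrder (f : ℝ → ℝ) (x : ℝ) : ℝ :=
  x * (derivWithin f (Ioi x) x - derivWithin f (Iio x) x)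

/-- **A divisor on `C_p`** (Definition 5.3 with Prop. 5.2 (ii)): "the maps `H ∈ C_p ↦ D(H) ∈ H` with
finite support". In the coordinate `λ` (`H = λH_p = (pλ)H_p`, Lemma 5.1 (i)): a function `D` on
`(0, ∞)` with `D(pλ) = D(λ)`, `D(λ) ∈ λH_p`, and finitely many non-zero values in the fundamental
domain `[1, p)`. (Values at `λ ≤ 0` are irrelevant.) [cite: ConnesConsani2017ScalingSite, Def. 5.3 (with Prop. 5.2 (ii), Lemma 5.1 (i))] -/
structure CpDivisor (p : ℕ) where
  /-- the value `D(λH_p)` as a function of `λ > 0` -/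
  toFun : ℝ → ℝ
  /-- `λH_p` and `pλH_p` are the same point -/
  periodic : ∀ x : ℝ, 0 < x → toFun (p * x) = toFun x
  /-- `D(H) ∈ H = λH_p` -/
  mem : ∀ x : ℝ, 0 < x → IsPFraction p (toFun x / x)
  /-- finite support (one representative `λ ∈ [1, p)` per point) -/
  finite_support : {x : ℝ | 1 ≤ x ∧ x < p ∧ toFun x ≠ 0}.Finite

namespace CpDivisor

variable {p : ℕ}

/-- The zero divisor. [folklore] -/
def zero (p : ℕ) : CpDivisor p where
  toFun := 0
  periodic _ _ := rfl
  mem x _ := by simpa using isPFraction_zero p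
  finite_support := by simp

/-- The partial order `D' ≥ D` "`∀ H ∈ C_p`" (Prop. 5.4 (ii)); `D.le E` means `D ≤ E` pointwise on
`(0, ∞)`. [cite: ConnesConsani2017ScalingSite, Prop. 5.4 (ii)] -/
def le (D E : CpDivisor p) : Prop := ∀ x : ℝ, 0 < x → D.toFun x ≤ E.toFun x

end CpDivisor

/-- **The degree** `deg(D) := Σ_H D(H) ∈ ℝ` (Prop. 5.4 (iii)), summed over one representative
`λ ∈ [1, p)` of each point (a finite sum, `finsum`). "A new feature of this construction is that the
degree of a divisor can be any real number" (§1). [cite: ConnesConsani2017ScalingSite, Prop. 5.4 (iii)] -/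
def cpDeg {p : ℕ} (D : CpDivisor p) : ℝ :=
  ∑ᶠ x ∈ {x : ℝ | 1 ≤ x ∧ x < p}, D.toFun x

/-- `χ : H_p → ℤ/(p-1)ℤ`, "`χ(a/p^n) := a` mod. `(p-1)`, for any `a ∈ ℤ` and `n ∈ ℕ`" (before Prop.
5.5), read off a representation `x = a/p^n` chosen by `Classical.choose` (independent of the choice
because `p ≡ 1 (mod p-1)`; junk value `0` off `H_p`). [cite: ConnesConsani2017ScalingSite, §5.1 (exact sequence before Prop. 5.5)] -/
def pFractionChi (p : ℕ) (x : ℝ) : ZMod (p - 1) := by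
  classical
  exact if h : IsPFraction p x then ((Classical.choose h : ℤ) : ZMod (p - 1)) else 0

/-- **The invariant `χ(D) := Σ_H χ_H(D(H)) ∈ ℤ/(p-1)ℤ`** (Prop. 5.5: `χ_H = χ ∘ λ⁻¹` for `H = λH_p`,
independent of the choice of `λ`), as a finite sum over the representatives `λ ∈ [1, p)`.
[cite: ConnesConsani2017ScalingSite, Prop. 5.5] -/
def cpChi {p : ℕ} (D : CpDivisor p) : ZMod (p - 1) :=
  ∑ᶠ x ∈ {x : ℝ | 1 ≤ x ∧ x < p}, pFractionChi p (D.toFun x / x)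

/-- **Principal divisors** (Prop. 5.4 (iv): "`(f) := Σ_H (H, ord_H(f))`"): `D` is principal when
`D(λ) = Order(f)(λ)` on `(0, ∞)` for some `f ∈ 𝒦(C_p)`. [cite: ConnesConsani2017ScalingSite, Prop. 5.4 (iv)] -/
def CpDivisor.IsPrincipal {p : ℕ} (D : CpDivisor p) : Prop :=
  ∃ f : ℝ → ℝ, IsCpRational p f ∧ ∀ x : ℝ, 0 < x → D.toFun x = cpOrder f x

/-- **`H⁰(D) := Γ(C_p, 𝒪(D)) = {f ∈ 𝒦(C_p) | D + (f) ≥ 0}`** (§5.4, eq. (43)), as a set of real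
functions; the source's convention that the constant `-∞` belongs to every `H⁰(D)` ("`H⁰(D) = 0`"
meaning no other element) becomes: `H⁰(D) = 0` iff this set is empty. [cite: ConnesConsani2017ScalingSite, §5.4 eq. (43)] -/
def cpH0 {p : ℕ} (D : CpDivisor p) : Set (ℝ → ℝ) :=
  {f | IsCpRational p f ∧ ∀ x : ℝ, 0 < x → 0 ≤ D.toFun x + cpOrder f x}

/-! ## The Jacobian of `C_p` (Theorem 5.6) and `H⁰` (Lemma 5.13) — named facts -/

/-- **Connes–Consani 2017, Theorem 5.6** (with Prop. 5.4 (iii),(v) and Prop. 5.5 (ii)), `p` prime: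
"The map defined by the pair of homomorphisms `(deg, χ) : Div(C_p)/𝒫 → ℝ × (ℤ/(p-1)ℤ)` is an
isomorphism of abelian groups": the principal divisors are exactly the divisors with `deg(D) = 0` and
`χ(D) = 0` (injectivity together with Prop. 5.4 (v) "`Σ_H ord_H(f) = 0`" and Prop. 5.5 (ii)), and
every pair `(d, c) ∈ ℝ × ℤ/(p-1)ℤ` is attained ("one can arbitrarily prescribe both `deg(D)` and
`χ(D)`"). [cite: ConnesConsani2017ScalingSite, Thm. 5.6 (with Prop. 5.4 (v), Prop. 5.5 (ii))] -/
def ConnesConsani2017_thm_5_6 : Prop :=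
  ∀ p : ℕ, p.Prime →
    (∀ D : CpDivisor p, D.IsPrincipal ↔ cpDeg D = 0 ∧ cpChi D = 0) ∧
      ∀ (d : ℝ) (c : ZMod (p - 1)), ∃ D : CpDivisor p, cpDeg D = d ∧ cpChi D = c

/-- **Connes–Consani 2017, Lemma 5.13**, `p` prime: "(i) If `deg(D) < 0` then `H⁰(D) = 0`. (ii) If
`deg(D) > 0` then `H⁰(D) ≠ 0`." (with `H⁰(D) = 0` ⇔ `cpH0 D = ∅`, see `cpH0`).
[cite: ConnesConsani2017ScalingSite, Lemma 5.13] -/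
def ConnesConsani2017_lemma_5_13 : Prop :=
  ∀ p : ℕ, p.Prime → ∀ D : CpDivisor p,
    (cpDeg D < 0 → cpH0 D = ∅) ∧ (0 < cpDeg D → (cpH0 D).Nonempty)

/-! ## Theta functions on `C_p` (§5.3) -/

/-- The basic **theta function** of `C_p` (§1 and §5.3, Lemma 5.10):
`θ(λ) := Σ_{m≥0} (0 ∨ (1 - p^m λ)) + Σ_{m≥1} (0 ∨ (p^{-m}λ - 1))` `= f₊(λ) + f₋(λ)`, the tropical
analogue of the product `∏(1 - t^m w) ∏(1 - t^m w⁻¹)` defining Jacobi's theta functions. Both series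
have finitely many non-zero terms for `λ > 0`. [cite: ConnesConsani2017ScalingSite, §5.3, Lemma 5.10] -/
def cpTheta (p : ℕ) (x : ℝ) : ℝ :=
  (∑' m : ℕ, max 0 (1 - (p : ℝ) ^ m * x)) + ∑' m : ℕ, max 0 (x / (p : ℝ) ^ (m + 1) - 1)

/-- **Connes–Consani 2017, Lemma 5.10 (ii)–(iii)**, `p` prime: "`θ(λ) := f₊(λ) + f₋(λ)` … is convex
(continuous), piecewise affine with slopes in `H_p` and fulfills the equation:
`θ(pλ) = θ(λ) + λ - 1`, `∀λ ∈ (0, ∞)`. (iii) One has `|θ(λ) - (λ/(p-1) - log λ/log p)| ≤ 1`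
`∀λ ∈ (0, ∞)`." We record convexity on `(0, ∞)`, the functional equation and the bound (iii).
[cite: ConnesConsani2017ScalingSite, Lemma 5.10 (ii)–(iii)] -/
def ConnesConsani2017_lemma_5_10 : Prop :=
  ∀ p : ℕ, p.Prime →
    ConvexOn ℝ (Ioi 0) (cpTheta p) ∧
      (∀ x : ℝ, 0 < x → cpTheta p (p * x) = cpTheta p x + x - 1) ∧
        ∀ x : ℝ, 0 < x →
          |cpTheta p x - (x / (p - 1) - Real.log x / Real.log p)| ≤ 1


/-! ## Riemann–Roch of type II on `C_p` (§5.4): `‖f‖_p`, the filtration `H⁰(D)^ρ`, the covering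
dimension, `Dim_ℝ`, Theorem 5.17 — appended 2026-08-19 (cc-1) -/

/-- Negation of a divisor (`-D` in the Riemann–Roch formula). [folklore] -/
def CpDivisor.neg {p : ℕ} (D : CpDivisor p) : CpDivisor p where
  toFun x := -D.toFun x
  periodic x hx := by rw [D.periodic x hx]
  mem x hx := by
    obtain ⟨a, n, ha⟩ := D.mem x hx
    exact ⟨-a, n, by rw [neg_div, ha]; push_cast; ring⟩
  finite_support := by
    apply D.finite_support.subset
    intro x hx
    simp only [mem_setOf_eq, ne_eq, neg_eq_zero] at hx ⊢
    exact hx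

/-- The `p`-adic absolute value `|h|_p` of an element `h = a/p^n ∈ H_p` (normalised by
`|p|_p = 1/p`, before Def. 5.14), as a real number, read off a representation chosen by
`Classical.choose` (Mathlib's `padicNorm p` of the rational `a/p^n`; junk `0` off `H_p`).
[cite: ConnesConsani2017ScalingSite, §5.4 (normalisation before Def. 5.14)] -/
def pFractionPadicNorm (p : ℕ) (x : ℝ) : ℝ := by
  classical
  exact if h : IsPFraction p x then
    ((padicNorm p ((Classical.choose h : ℤ) /
        (p : ℚ) ^ (Classical.choose (Classical.choose_spec h) : ℕ)) : ℚ) : ℝ)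
  else 0

/-- **Definition 5.14**: "`‖f‖_p := max {|h(λ)|_p/λ | λ ∈ ℝ₊*}` where `h(λ) ∈ H_p` is the slope of `f`
at `λ`" (at a break point "one takes the max of the two values `|h_±(λ)|_p/λ`"); by the invariance
of `|h(λ)|_p/λ` under `λ ↦ pλ` the max is over `λ ∈ [1, p]` (proof of Prop. 5.15 (iv)). Rendered
as the `sSup` over `λ ∈ [1, p]` of both one-sided values (a finite set of values for
`f ∈ 𝒦(C_p)`). [cite: ConnesConsani2017ScalingSite, Def. 5.14 (with Prop. 5.15 (iv))] -/
def cpSlopeNorm (p : ℕ) (f : ℝ → ℝ) : ℝ :=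
  sSup (((fun x => pFractionPadicNorm p (derivWithin f (Ioi x) x) / x) '' Icc (1 : ℝ) p) ∪
    ((fun x => pFractionPadicNorm p (derivWithin f (Iio x) x) / x) '' Icc (1 : ℝ) p))

/-- **Proposition 5.15 (v)**: the level `H⁰(D)^ρ := {f ∈ H⁰(D) | ‖f‖_p ≤ ρ}` of the increasing
filtration of `H⁰(D)` by `ℝ_max`-submodules, as a TYPE (for its covering dimension), endowed below
with "the topology of uniform convergence for … functions on the interval `[1, p]`" (metric
`d(f, g) = max_{x ∈ [1,p]} |f(x) - g(x)|`, eq. (46)). [cite: ConnesConsani2017ScalingSite, Prop. 5.15 (v) and eq. (46)] -/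
def CpH0Level {p : ℕ} (D : CpDivisor p) (ρ : ℝ) : Type :=
  {f : ℝ → ℝ // f ∈ cpH0 D ∧ cpSlopeNorm p f ≤ ρ}

/-- The topology of uniform convergence on `[1, p]` on `H⁰(D)^ρ` (eq. (46)): induced from Mathlib's
uniform-convergence structure `↥[1,p] →ᵤ ℝ` by restriction. [cite: ConnesConsani2017ScalingSite, §5.4 eq. (46)] -/
instance CpH0Level.instTopologicalSpace {p : ℕ} (D : CpDivisor p) (ρ : ℝ) :
    TopologicalSpace (CpH0Level D ρ) :=
  TopologicalSpace.induced
    (fun f : CpH0Level D ρ => UniformFun.ofFun (fun x : Icc (1 : ℝ) (p : ℝ) => f.1 (x : ℝ)))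
    inferInstance

/-- "every open cover `𝒰` of `X` admits a refinement `𝒱` such that every point of `X` is in at most
`n + 1` elements of `𝒱`" (Def. 5.16; covers and refinements as sets of open sets).
[cite: ConnesConsani2017ScalingSite, Def. 5.16] -/
def HasCoveringDimLE (X : Type*) [TopologicalSpace X] (n : ℕ) : Prop :=
  ∀ 𝒰 : Set (Set X), (∀ U ∈ 𝒰, IsOpen U) → ⋃₀ 𝒰 = univ →
    ∃ 𝒱 : Set (Set X), (∀ V ∈ 𝒱, IsOpen V) ∧ ⋃₀ 𝒱 = univ ∧ (∀ V ∈ 𝒱, ∃ U ∈ 𝒰, V ⊆ U) ∧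
      ∀ x : X, ({V | V ∈ 𝒱 ∧ x ∈ V} : Set (Set X)).encard ≤ n + 1

/-- **Definition 5.16** (Lebesgue covering dimension, [Pears]): "The topological dimension
`dim_top(X)` of `X` is the smallest integer `n` such that every open cover `𝒰` of `X` admits a
refinement `𝒱` such that every point of `X` is in at most `n + 1` elements of `𝒱`" (`⊤` if there is
no such `n`). Mathlib has no covering dimension; this is a local rendering for Thm. 5.17.
[cite: ConnesConsani2017ScalingSite, Def. 5.16] -/
def coveringDim (X : Type*) [TopologicalSpace X] : ℕ∞ :=
  ⨅ (n : ℕ) (_ : HasCoveringDimLE X n), (n : ℕ∞)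

/-- The normalised dimensions `p^{-n} dim_top(H⁰(D)^{p^n})` whose limit is the **continuous
dimension** `Dim_ℝ(H⁰(D)) := lim_{n→∞} p^{-n} dim_top(H⁰(D)^{p^n})` (eq. (47)). (`ℕ∞` read through
`toNat`, junk `0` at `⊤`; the fact below asserts finiteness where the source proves it.)
[cite: ConnesConsani2017ScalingSite, §5.4 eq. (47)] -/
def cpDimSeq {p : ℕ} (D : CpDivisor p) (n : ℕ) : ℝ :=
  ((coveringDim (CpH0Level D ((p : ℝ) ^ n))).toNat : ℝ) / (p : ℝ) ^ n

/-- **Connes–Consani 2017, Theorem 5.17 (Riemann–Roch of type II on `C_p`)**, `p` prime: "(i) Let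
`D ∈ Div(C_p)` be a divisor with `deg(D) ≥ 0`. Then the limit in (47) converges and one has
`Dim_ℝ(H⁰(D)) = deg(D)`. (ii) The Riemann–Roch formula holds
`Dim_ℝ(H⁰(D)) - Dim_ℝ(H⁰(-D)) = deg(D)` `∀ D ∈ Div(C_p)`." Rendered with `Dim_ℝ` as the limit of
`cpDimSeq` (covering dimensions finite along the filtration, as in the proof via Lemmas 5.18–5.19).
[cite: ConnesConsani2017ScalingSite, Thm. 5.17] -/
def ConnesConsani2017_thm_5_17 : Prop :=
  ∀ p : ℕ, p.Prime → ∀ D : CpDivisor p,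
    (0 ≤ cpDeg D →
      (∀ n : ℕ, coveringDim (CpH0Level D ((p : ℝ) ^ n)) ≠ ⊤) ∧
        Tendsto (cpDimSeq D) atTop (𝓝 (cpDeg D))) ∧
    ∃ a b : ℝ, Tendsto (cpDimSeq D) atTop (𝓝 a) ∧ Tendsto (cpDimSeq D.neg) atTop (𝓝 b) ∧
      a - b = cpDeg D


/-! ## Sanity / non-vacuity: constants are rational functions with zero divisor — appended 2026-08-19 -/

/-- Constant functions belong to `𝒦(C_p)` (one affine piece `[1, p]` of slope `0 ∈ H_p`), for `p > 1`.
[folklore] -/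
theorem isCpRational_const {p : ℕ} (hp : 1 < p) (c : ℝ) : IsCpRational p (fun _ => c) := by
  refine ⟨fun _ _ => rfl, 0, ![1, (p : ℝ)], ![0], by simp, ?_, ?_, ?_, ?_⟩
  · refine Fin.strictMono_iff_lt_succ.mpr ?_
    intro i
    fin_cases i
    simpa using (by exact_mod_cast hp : (1 : ℝ) < p)
  · simp
  · intro j
    fin_cases j
    simpa using isPFraction_zero p
  · intro j x _ _
    fin_cases j
    simp

/-- The order of a constant function vanishes everywhere (`Ord = h₊ - h₋ = 0`). [folklore] -/
@[simp] theorem cpOrder_const (c x : ℝ) : cpOrder (fun _ => c) x = 0 := by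
  simp [cpOrder]

/-- The zero divisor is principal (it is the divisor of any constant), `p > 1`. [folklore] -/
theorem CpDivisor.zero_isPrincipal {p : ℕ} (hp : 1 < p) : (CpDivisor.zero p).IsPrincipal :=
  ⟨fun _ => 0, isCpRational_const hp 0, fun x _ => by simp [CpDivisor.zero]⟩

/-- `H⁰(0) ∋` the constants, in particular `H⁰(0) ≠ 0` (cf. Lemma 5.13 and Thm. 5.17 at `deg D = 0`,
`D` principal). [folklore] -/
theorem const_mem_cpH0_zero {p : ℕ} (hp : 1 < p) (c : ℝ) : (fun _ => c) ∈ cpH0 (CpDivisor.zero p) :=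
  ⟨isCpRational_const hp c, fun x _ => by simp [CpDivisor.zero]⟩


/-! ## Discharge of Lemma 5.10 (ii)–(iii): the theta function — appended 2026-08-19 -/

section ThetaProof

/-- A term of `f₊` vanishes once `p^m t ≥ 1`. [folklore] -/
private theorem fPlus_eq_zero {p : ℕ} {t : ℝ} {m : ℕ} (h : 1 ≤ (p : ℝ) ^ m * t) :
    max 0 (1 - (p : ℝ) ^ m * t) = 0 :=
  max_eq_left (by linarith)

/-- A term of `f₋` vanishes once `t ≤ p^{m+1}`. [folklore] -/
private theorem fMinus_eq_zero {p : ℕ} {t : ℝ} {m : ℕ} (hp : 0 < (p : ℝ))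
    (h : t ≤ (p : ℝ) ^ (m + 1)) : max 0 (t / (p : ℝ) ^ (m + 1) - 1) = 0 :=
  max_eq_left (by rw [sub_nonpos, div_le_one (pow_pos hp _)]; exact h)

/-- Uniform truncation of both series on a compact range `[lo, hi] ⊂ (0, ∞)`. [folklore] -/
private theorem theta_exists_trunc {p : ℕ} (hp : 1 < p) {lo : ℝ} (hi : ℝ) (hlo : 0 < lo) :
    ∃ N : ℕ, ∀ t : ℝ, lo ≤ t → t ≤ hi → ∀ m : ℕ, N ≤ m →
      max 0 (1 - (p : ℝ) ^ m * t) = 0 ∧ max 0 (t / (p : ℝ) ^ (m + 1) - 1) = 0 := by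
  have hp1 : (1 : ℝ) < p := by exact_mod_cast hp
  have hp0 : (0 : ℝ) < p := by positivity
  obtain ⟨N₁, hN₁⟩ := pow_unbounded_of_one_lt (1 / lo) hp1
  obtain ⟨N₂, hN₂⟩ := pow_unbounded_of_one_lt hi hp1
  refine ⟨max N₁ N₂, fun t hlt hth m hm => ⟨?_, ?_⟩⟩
  · apply fPlus_eq_zero
    have h1 : (p : ℝ) ^ N₁ ≤ (p : ℝ) ^ m :=
      pow_le_pow_right₀ hp1.le (le_trans (le_max_left _ _) hm)
    have h2 : 1 / lo < (p : ℝ) ^ m := lt_of_lt_of_le hN₁ h1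
    have h3 : 1 < (p : ℝ) ^ m * lo := by
      rw [div_lt_iff₀ hlo] at h2
      linarith
    nlinarith [pow_pos hp0 m]
  · apply fMinus_eq_zero hp0
    have h1 : (p : ℝ) ^ N₂ ≤ (p : ℝ) ^ (m + 1) :=
      pow_le_pow_right₀ hp1.le (by omega)
    linarith

/-- On `[lo, hi]` the theta function is a finite sum. [folklore] -/
private theorem cpTheta_eq_finset_sum {p : ℕ} (hp : 1 < p) {lo : ℝ} (hi : ℝ) (hlo : 0 < lo) :
    ∃ N : ℕ, ∀ t : ℝ, lo ≤ t → t ≤ hi →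
      cpTheta p t = ∑ m ∈ Finset.range N,
        (max 0 (1 - (p : ℝ) ^ m * t) + max 0 (t / (p : ℝ) ^ (m + 1) - 1)) := by
  obtain ⟨N, hN⟩ := theta_exists_trunc hp hi hlo
  refine ⟨N, fun t h1 h2 => ?_⟩
  have hz := hN t h1 h2
  unfold cpTheta
  rw [tsum_eq_sum (s := Finset.range N)
        (fun m hm => (hz m (by simpa [Finset.mem_range] using hm)).1),
    tsum_eq_sum (s := Finset.range N)
        (fun m hm => (hz m (by simpa [Finset.mem_range] using hm)).2),
    ← Finset.sum_add_distrib]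

/-- `t ↦ max 0 (ct + d)` is convex. [folklore] -/
private theorem convexOn_max_zero_affine (c d : ℝ) :
    ConvexOn ℝ Set.univ (fun t : ℝ => max 0 (c * t + d)) := by
  refine ⟨convex_univ, fun x _ y _ a b ha hb hab => ?_⟩
  simp only [smul_eq_mul]
  apply max_le
  · exact add_nonneg (mul_nonneg ha (le_max_left _ _)) (mul_nonneg hb (le_max_left _ _))
  · have hx : c * x + d ≤ max 0 (c * x + d) := le_max_right _ _
    have hy : c * y + d ≤ max 0 (c * y + d) := le_max_right _ _
    have heq : c * (a * x + b * y) + d = a * (c * x + d) + b * (c * y + d) := by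
      calc c * (a * x + b * y) + d
          = a * (c * x + d) + b * (c * y + d) + (1 - (a + b)) * d := by ring
        _ = a * (c * x + d) + b * (c * y + d) := by rw [hab]; ring
    rw [heq]
    exact add_le_add (mul_le_mul_of_nonneg_left hx ha) (mul_le_mul_of_nonneg_left hy hb)

/-- The truncated theta sums are convex on `ℝ`. [folklore] -/
private theorem convexOn_thetaTrunc (p N : ℕ) :
    ConvexOn ℝ Set.univ (fun t : ℝ => ∑ m ∈ Finset.range N,
      (max 0 (1 - (p : ℝ) ^ m * t) + max 0 (t / (p : ℝ) ^ (m + 1) - 1))) := by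
  induction N with
  | zero =>
    simp only [Finset.range_zero, Finset.sum_empty]
    exact convexOn_const 0 convex_univ
  | succ n ih =>
    simp only [Finset.sum_range_succ]
    have h1 : ConvexOn ℝ Set.univ (fun t : ℝ => max 0 (1 - (p : ℝ) ^ n * t)) := by
      have : (fun t : ℝ => max 0 (1 - (p : ℝ) ^ n * t)) =
          fun t => max 0 ((-(p : ℝ) ^ n) * t + 1) := by
        funext t; congr 1; ring
      rw [this]; exact convexOn_max_zero_affine _ _
    have h2 : ConvexOn ℝ Set.univ (fun t : ℝ => max 0 (t / (p : ℝ) ^ (n + 1) - 1)) := by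
      have : (fun t : ℝ => max 0 (t / (p : ℝ) ^ (n + 1) - 1)) =
          fun t => max 0 ((1 / (p : ℝ) ^ (n + 1)) * t + (-1)) := by
        funext t; congr 1; ring
      rw [this]; exact convexOn_max_zero_affine _ _
    exact ih.add (h1.add h2)

/-- Lemma 5.10 (ii), convexity: `θ` is convex on `(0, ∞)`. [cite: ConnesConsani2017ScalingSite, Lemma 5.10 (ii)] -/
theorem convexOn_cpTheta {p : ℕ} (hp : 1 < p) : ConvexOn ℝ (Ioi 0) (cpTheta p) := by
  refine ⟨convex_Ioi 0, fun x hx y hy a b ha hb hab => ?_⟩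
  have hx' : (0 : ℝ) < x := hx
  have hy' : (0 : ℝ) < y := hy
  obtain ⟨N, hN⟩ := cpTheta_eq_finset_sum hp (max x y) (lt_min hx' hy')
  have hz1 : min x y ≤ a • x + b • y := by
    simp only [smul_eq_mul]
    have e : a * min x y + b * min x y = min x y := by rw [← add_mul, hab, one_mul]
    linarith [mul_le_mul_of_nonneg_left (min_le_left x y) ha,
      mul_le_mul_of_nonneg_left (min_le_right x y) hb]
  have hz2 : a • x + b • y ≤ max x y := by
    simp only [smul_eq_mul]
    have e : a * max x y + b * max x y = max x y := by rw [← add_mul, hab, one_mul]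
    linarith [mul_le_mul_of_nonneg_left (le_max_left x y) ha,
      mul_le_mul_of_nonneg_left (le_max_right x y) hb]
  rw [hN _ hz1 hz2, hN x (min_le_left _ _) (le_max_left _ _),
    hN y (min_le_right _ _) (le_max_right _ _)]
  exact (convexOn_thetaTrunc p N).2 (Set.mem_univ x) (Set.mem_univ y) ha hb hab

/-- Lemma 5.10 (ii), functional equation: `θ(pλ) = θ(λ) + λ - 1` for `λ > 0`. [cite: ConnesConsani2017ScalingSite, Lemma 5.10 (ii)] -/
theorem cpTheta_mul {p : ℕ} (hp : 1 < p) {x : ℝ} (hx : 0 < x) :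
    cpTheta p (p * x) = cpTheta p x + x - 1 := by
  have hp1 : (1 : ℝ) < p := by exact_mod_cast hp
  have hp0 : (0 : ℝ) < p := by positivity
  set g : ℕ → ℝ := fun m => max 0 (1 - (p : ℝ) ^ m * x) with hg
  set k : ℕ → ℝ := fun m => max 0 (x / (p : ℝ) ^ m - 1) with hk
  obtain ⟨N, hN⟩ := theta_exists_trunc hp x hx
  have hgs : Summable g :=
    summable_of_ne_finset_zero (s := Finset.range N)
      (fun m hm => (hN x le_rfl le_rfl m (by simpa [Finset.mem_range] using hm)).1)
  have hks1 : Summable (fun m => k (m + 1)) :=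
    summable_of_ne_finset_zero (s := Finset.range N)
      (fun m hm => (hN x le_rfl le_rfl m (by simpa [Finset.mem_range] using hm)).2)
  have hks : Summable k := (summable_nat_add_iff 1).mp hks1
  have h1 : (fun m : ℕ => max 0 (1 - (p : ℝ) ^ m * ((p : ℝ) * x))) = fun m => g (m + 1) := by
    funext m
    simp only [hg, pow_succ]
    ring_nf
  have h2 : (fun m : ℕ => max 0 ((p : ℝ) * x / (p : ℝ) ^ (m + 1) - 1)) = k := by
    funext m
    simp only [hk]
    rw [pow_succ, mul_comm (p : ℝ) x, mul_div_mul_right _ _ hp0.ne']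
  have e0 : cpTheta p ((p : ℝ) * x) = (∑' m, g (m + 1)) + ∑' m, k m := by
    unfold cpTheta
    rw [h1, h2]
  have e1 : ∑' m, g (m + 1) = (∑' m, g m) - g 0 := by
    rw [hgs.tsum_eq_zero_add]
    ring
  have e2 : ∑' m, k m = k 0 + ∑' m, k (m + 1) := hks.tsum_eq_zero_add
  have e3 : cpTheta p x = (∑' m, g m) + ∑' m, k (m + 1) := rfl
  have e4 : k 0 - g 0 = x - 1 := by
    have h := max_zero_sub_eq_self (x - 1)
    simp only [hg, hk, pow_zero, one_mul, div_one]
    rw [max_comm 0 (x - 1), max_comm 0 (1 - x), show (1 - x) = -(x - 1) by ring]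
    exact h
  rw [e0, e1, e2, e3]
  linarith

/-- `θ` vanishes on the fundamental domain `[1, p]`. [cite: ConnesConsani2017ScalingSite, Lemma 5.10 (proof of (iii): "θ(u) = 0 ∀ u ∈ [1,p]")] -/
theorem cpTheta_eq_zero_of_mem_Icc {p : ℕ} (hp : 1 < p) {t : ℝ} (h1 : 1 ≤ t) (h2 : t ≤ p) :
    cpTheta p t = 0 := by
  have hp1 : (1 : ℝ) ≤ p := by exact_mod_cast hp.le
  have hp0 : (0 : ℝ) < p := by positivity
  have e1 : ∀ m : ℕ, max 0 (1 - (p : ℝ) ^ m * t) = 0 := fun m =>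
    fPlus_eq_zero (by nlinarith [one_le_pow₀ (M₀ := ℝ) hp1 (n := m)])
  have e2 : ∀ m : ℕ, max 0 (t / (p : ℝ) ^ (m + 1) - 1) = 0 := fun m =>
    fMinus_eq_zero hp0 (le_trans h2 (le_self_pow₀ hp1 (Nat.succ_ne_zero m)))
  unfold cpTheta
  simp [e1, e2]

/-- The comparison function `u/(p-1) - log u/log p` lies in `[-1, 1]` on `[1, p]` (it is convex with
value `1/(p-1)` at both ends). [cite: ConnesConsani2017ScalingSite, Lemma 5.10 (proof of (iii))] -/
private theorem theta_gfun_bound {p : ℕ} (hp : 2 ≤ p) {t : ℝ} (h1 : 1 ≤ t) (h2 : t ≤ p) :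
    |t / ((p : ℝ) - 1) - Real.log t / Real.log p| ≤ 1 := by
  have hp2 : (2 : ℝ) ≤ p := by exact_mod_cast hp
  have hlogp : 0 < Real.log p := Real.log_pos (by linarith)
  rw [abs_le]
  constructor
  · have ha : 0 ≤ t / ((p : ℝ) - 1) := div_nonneg (by linarith) (by linarith)
    have hb : Real.log t / Real.log p ≤ 1 := by
      rw [div_le_one hlogp]
      exact Real.log_le_log (by linarith) h2
    linarith
  · have hconv : ConvexOn ℝ (Ioi (0 : ℝ))
        (fun u : ℝ => u / ((p : ℝ) - 1) - Real.log u / Real.log p) := by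
      have hlin : ConvexOn ℝ (Ioi (0 : ℝ)) (fun u : ℝ => u / ((p : ℝ) - 1)) := by
        have hc : (0 : ℝ) ≤ 1 / ((p : ℝ) - 1) := div_nonneg zero_le_one (by linarith)
        have := (convexOn_id (convex_Ioi (0 : ℝ))).smul hc
        refine this.congr ?_
        intro u _
        simp only [smul_eq_mul, id]
        ring
      have hlog : ConcaveOn ℝ (Ioi (0 : ℝ)) (fun u : ℝ => Real.log u / Real.log p) := by
        have hc : (0 : ℝ) ≤ 1 / Real.log p := div_nonneg zero_le_one hlogp.le
        have := (strictConcaveOn_log_Ioi).concaveOn.smul hc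
        refine this.congr ?_
        intro u _
        simp only [smul_eq_mul]
        ring
      exact hlin.sub hlog
    have hseg := hconv.le_on_segment (show (1 : ℝ) ∈ Ioi (0 : ℝ) by norm_num)
      (show (p : ℝ) ∈ Ioi (0 : ℝ) by simp only [Set.mem_Ioi]; linarith)
      (by rw [segment_eq_Icc (by linarith : (1 : ℝ) ≤ p)]; exact ⟨h1, h2⟩)
    have f1 : (1 : ℝ) / ((p : ℝ) - 1) - Real.log 1 / Real.log p = 1 / ((p : ℝ) - 1) := by simp
    have hpm1 : (p : ℝ) - 1 ≠ 0 := by linarith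
    have fp : (p : ℝ) / ((p : ℝ) - 1) - Real.log p / Real.log p = 1 / ((p : ℝ) - 1) := by
      rw [div_self hlogp.ne']
      field_simp
      ring
    have hle : 1 / ((p : ℝ) - 1) ≤ 1 := by
      rw [div_le_one (by linarith)]
      linarith
    rw [f1, fp, max_self] at hseg
    linarith

/-- The defect `k = θ - g` is invariant under `λ ↦ pλ` (proof of Lemma 5.10 (iii)). [cite: ConnesConsani2017ScalingSite, Lemma 5.10 (proof of (iii))] -/
private theorem theta_defect_mul {p : ℕ} (hp : 1 < p) {t : ℝ} (ht : 0 < t) :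
    cpTheta p ((p : ℝ) * t) - ((p : ℝ) * t / ((p : ℝ) - 1) - Real.log ((p : ℝ) * t) / Real.log p)
      = cpTheta p t - (t / ((p : ℝ) - 1) - Real.log t / Real.log p) := by
  have hp1 : (1 : ℝ) < p := by exact_mod_cast hp
  rw [cpTheta_mul hp ht, Real.log_mul (by positivity) ht.ne']
  have hlogp : Real.log p ≠ 0 := (Real.log_pos hp1).ne'
  have hpm1 : (p : ℝ) - 1 ≠ 0 := by linarith
  field_simp
  ring

/-- Iterated invariance: `k(p^n t) = k(t)`. [folklore] -/
private theorem theta_defect_pow_mul {p : ℕ} (hp : 1 < p) {t : ℝ} (ht : 0 < t) (n : ℕ) :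
    cpTheta p ((p : ℝ) ^ n * t) - ((p : ℝ) ^ n * t / ((p : ℝ) - 1) -
        Real.log ((p : ℝ) ^ n * t) / Real.log p)
      = cpTheta p t - (t / ((p : ℝ) - 1) - Real.log t / Real.log p) := by
  induction n with
  | zero => simp
  | succ n ih =>
    have hp1r : (1 : ℝ) < p := by exact_mod_cast hp
    have hp0 : (0 : ℝ) < p := by linarith
    have hpos : 0 < (p : ℝ) ^ n * t := by positivity
    rw [show (p : ℝ) ^ (n + 1) * t = (p : ℝ) * ((p : ℝ) ^ n * t) by ring,
      theta_defect_mul hp hpos, ih]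

/-- The bound for `x ≥ 1`, by reduction to `[1, p]`. [folklore] -/
private theorem theta_bound_of_one_le {p : ℕ} (hp : 2 ≤ p) :
    ∀ n : ℕ, ∀ x : ℝ, 1 ≤ x → x < (p : ℝ) ^ (n + 1) →
      |cpTheta p x - (x / ((p : ℝ) - 1) - Real.log x / Real.log p)| ≤ 1 := by
  have hp1 : 1 < p := by omega
  have hp1r : (1 : ℝ) < p := by exact_mod_cast hp1
  have hp0 : (0 : ℝ) < p := by positivity
  intro n
  induction n with
  | zero =>
    intro x h1 h2
    rw [zero_add, pow_one] at h2
    rw [cpTheta_eq_zero_of_mem_Icc hp1 h1 h2.le, zero_sub, abs_neg]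
    exact theta_gfun_bound hp h1 h2.le
  | succ n ih =>
    intro x h1 h2
    by_cases hlt : x < (p : ℝ) ^ (n + 1)
    · exact ih x h1 hlt
    · push Not at hlt
      have hxp : 0 < x / p := div_pos (by linarith) hp0
      have hx1 : 1 ≤ x / p := by
        rw [le_div_iff₀ hp0, one_mul]
        exact le_trans (le_self_pow₀ hp1r.le (Nat.succ_ne_zero n)) hlt
      have hx2 : x / p < (p : ℝ) ^ (n + 1) := by
        rw [div_lt_iff₀ hp0, ← pow_succ]
        exact h2
      have key := theta_defect_mul hp1 hxp
      rw [mul_div_cancel₀ _ hp0.ne'] at key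
      rw [key]
      exact ih (x / p) hx1 hx2

/-- Lemma 5.10 (iii): `|θ(λ) - (λ/(p-1) - log λ / log p)| ≤ 1` for `λ > 0`.
[cite: ConnesConsani2017ScalingSite, Lemma 5.10 (iii)] -/
theorem abs_cpTheta_sub_le {p : ℕ} (hp : 2 ≤ p) {x : ℝ} (hx : 0 < x) :
    |cpTheta p x - (x / ((p : ℝ) - 1) - Real.log x / Real.log p)| ≤ 1 := by
  have hp1 : 1 < p := by omega
  have hp1r : (1 : ℝ) < p := by exact_mod_cast hp1
  -- scale `x` up into `[1, ∞)`
  obtain ⟨n, hn⟩ := pow_unbounded_of_one_lt (1 / x) hp1r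
  have hy1 : 1 ≤ (p : ℝ) ^ n * x := by
    rw [div_lt_iff₀ hx] at hn
    linarith
  obtain ⟨N, hN⟩ := pow_unbounded_of_one_lt ((p : ℝ) ^ n * x) hp1r
  have hy2 : (p : ℝ) ^ n * x < (p : ℝ) ^ (N + 1) :=
    lt_trans hN (pow_lt_pow_right₀ hp1r (Nat.lt_succ_self N))
  have h := theta_bound_of_one_le hp N ((p : ℝ) ^ n * x) hy1 hy2
  rwa [theta_defect_pow_mul hp1 hx n] at h

end ThetaProof

/-- **Proof of `ConnesConsani2017_lemma_5_10`** (Connes–Consani 2017, Lemma 5.10 (ii)–(iii)): the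
theta series are finite sums of convex "hinge" functions on every compact range (convexity);
shifting the summation index gives `θ(pλ) - θ(λ) = (0 ∨ (λ-1)) - (0 ∨ (1-λ)) = λ - 1`; and
`k = θ - g`, `g(u) = u/(p-1) - log u/log p`, satisfies `k(pλ) = k(λ)`, `θ = 0` on `[1,p]`, `|g| ≤ 1`
on `[1,p]` (convexity of `g`, values `1/(p-1)` at the end points), as in the printed proof.
[cite: ConnesConsani2017ScalingSite, Lemma 5.10 (ii)–(iii)] -/
theorem ConnesConsani2017_lemma_5_10_holds : ConnesConsani2017_lemma_5_10 := by
  intro p hp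
  refine ⟨convexOn_cpTheta hp.one_lt, fun x hx => cpTheta_mul hp.one_lt hx, fun x hx => ?_⟩
  exact abs_cpTheta_sub_le hp.two_le hx


/-! ## Piecewise-affine calculus on `C_p` (Prop. 5.4 (v), Prop. 5.5 (ii)) — appended 2026-08-19 (cc-1 gen 2)

Infrastructure for the divisor theory of `𝒦(C_p)`: the group `H_p` and the character `χ`,
one-sided derivatives of piecewise-affine functions, the effect of the periodicity `f(pλ) = f(λ)`
on slopes ("the slope `h_±(pλ)` of `f` at `pλ` is `h_±(λ)/p`", §5.4), the orders of `f ∈ 𝒦(C_p)`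
over one period, sums of `p`-invariant functions over a fundamental domain, and the two printed
consequences **Prop. 5.4 (v)** "`Σ_H ord_H(f) = 0`" and **Prop. 5.5 (ii)** "`χ((f)) = 0`". -/

section HpChi

variable {p : ℕ}

/-! ### The group `H_p` -/

/-- `H_p` is closed under negation. [folklore] -/
theorem IsPFraction.neg {x : ℝ} (hx : IsPFraction p x) : IsPFraction p (-x) := by
  obtain ⟨a, n, rfl⟩ := hx
  exact ⟨-a, n, by push_cast; ring⟩

/-- `H_p` is closed under addition (`p ≠ 0`). [folklore] -/
theorem IsPFraction.add (hp : p ≠ 0) {x y : ℝ} (hx : IsPFraction p x) (hy : IsPFraction p y) :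
    IsPFraction p (x + y) := by
  obtain ⟨a, m, rfl⟩ := hx
  obtain ⟨b, n, rfl⟩ := hy
  have hp0 : (p : ℝ) ≠ 0 := by exact_mod_cast hp
  refine ⟨a * p ^ n + b * p ^ m, m + n, ?_⟩
  push_cast
  rw [pow_add]
  field_simp

/-- `H_p` is closed under subtraction (`p ≠ 0`). [folklore] -/
theorem IsPFraction.sub (hp : p ≠ 0) {x y : ℝ} (hx : IsPFraction p x) (hy : IsPFraction p y) :
    IsPFraction p (x - y) := by
  rw [sub_eq_add_neg]; exact hx.add hp hy.neg

/-- `H_p` is stable under integer multiples. [folklore] -/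
theorem IsPFraction.int_mul {x : ℝ} (hx : IsPFraction p x) (k : ℤ) : IsPFraction p (k * x) := by
  obtain ⟨a, n, rfl⟩ := hx
  exact ⟨k * a, n, by push_cast; ring⟩

/-- `H_p` is stable under multiplication by `p`. [folklore] -/
theorem IsPFraction.mul_p {x : ℝ} (hx : IsPFraction p x) : IsPFraction p (p * x) := by
  obtain ⟨a, n, rfl⟩ := hx
  exact ⟨p * a, n, by push_cast; ring⟩

/-- `H_p` is stable under division by `p`. [folklore] -/
theorem IsPFraction.div_p {x : ℝ} (hx : IsPFraction p x) : IsPFraction p (x / p) := by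
  obtain ⟨a, n, rfl⟩ := hx
  exact ⟨a, n + 1, by rw [pow_succ]; ring⟩

/-- `x/p ∈ H_p ⇔ x ∈ H_p` (`p ≠ 0`). [folklore] -/
theorem isPFraction_div_p_iff (hp : p ≠ 0) {x : ℝ} : IsPFraction p (x / p) ↔ IsPFraction p x := by
  refine ⟨fun h ↦ ?_, IsPFraction.div_p⟩
  have hp0 : (p : ℝ) ≠ 0 := by exact_mod_cast hp
  have := h.mul_p
  rwa [mul_div_cancel₀ _ hp0] at this

/-- `H_p` is stable under division by `p^k`. [folklore] -/
theorem IsPFraction.div_pow {x : ℝ} (hx : IsPFraction p x) (k : ℕ) :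
    IsPFraction p (x / (p : ℝ) ^ k) := by
  induction k with
  | zero => simpa using hx
  | succ k ih =>
    have := ih.div_p
    rwa [pow_succ, ← div_div]

/-- `H_p` is stable under multiplication by `p^k`. [folklore] -/
theorem IsPFraction.mul_pow {x : ℝ} (hx : IsPFraction p x) (k : ℕ) :
    IsPFraction p ((p : ℝ) ^ k * x) := by
  induction k with
  | zero => simpa using hx
  | succ k ih =>
    have := ih.mul_p
    rw [pow_succ]
    convert this using 1
    ring

/-- `H_p` is stable under multiplication by `p^k`, `k ∈ ℤ`. [folklore] -/
theorem IsPFraction.mul_zpow {x : ℝ} (hx : IsPFraction p x) (k : ℤ) :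
    IsPFraction p ((p : ℝ) ^ k * x) := by
  obtain ⟨m, rfl | rfl⟩ := k.eq_nat_or_neg
  · rw [zpow_natCast]; exact hx.mul_pow m
  · rw [zpow_neg, zpow_natCast, inv_mul_eq_div]; exact hx.div_pow m

/-! ### The character `χ : H_p → ℤ/(p-1)ℤ` is well defined and additive (Prop. 5.5) -/

/-- `p ≡ 1 (mod p - 1)`. [folklore] -/
theorem natCast_p_zmod_pred (hp : 0 < p) : ((p : ℕ) : ZMod (p - 1)) = 1 := by
  have e : ((p - 1 : ℕ) : ZMod (p - 1)) + 1 = ((p : ℕ) : ZMod (p - 1)) := by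
    rw [← Nat.cast_succ]
    congr 1
    omega
  rw [← e, ZMod.natCast_self, zero_add]

/-- **`χ` is well defined**: `χ(a/p^n) = a mod (p-1)`, whatever the representation (since
`p ≡ 1 (mod p-1)`; Prop. 5.5 / the exact sequence `0 → H_p^{(0)} → H_p → ℤ/(p-1)ℤ → 0`).
[cite: ConnesConsani2017ScalingSite, §5.1 (before Prop. 5.5)] -/
theorem pFractionChi_eq (hp : 0 < p) {x : ℝ} {a : ℤ} {n : ℕ} (h : x = a / (p : ℝ) ^ n) :
    pFractionChi p x = (a : ZMod (p - 1)) := by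
  classical
  have hx : IsPFraction p x := ⟨a, n, h⟩
  unfold pFractionChi
  rw [dif_pos hx]
  obtain ⟨n', hn'⟩ := Classical.choose_spec hx
  set a' : ℤ := Classical.choose hx with ha'
  have hp0 : (p : ℝ) ≠ 0 := by exact_mod_cast hp.ne'
  have key : (a : ℝ) * (p : ℝ) ^ n' = (a' : ℝ) * (p : ℝ) ^ n := by
    rw [h] at hn'
    field_simp at hn'
    linear_combination hn'
  have keyZ : a * (p : ℤ) ^ n' = a' * (p : ℤ) ^ n := by exact_mod_cast key
  have := congrArg (Int.cast : ℤ → ZMod (p - 1)) keyZ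
  push_cast at this
  rw [natCast_p_zmod_pred hp, one_pow, mul_one, one_pow, mul_one] at this
  exact this.symm

/-- `χ = 0` off `H_p` (junk value). [folklore] -/
theorem pFractionChi_of_not {x : ℝ} (hx : ¬ IsPFraction p x) : pFractionChi p x = 0 := by
  classical
  unfold pFractionChi
  rw [dif_neg hx]

/-- **`χ` is additive on `H_p`.** [cite: ConnesConsani2017ScalingSite, §5.1 (before Prop. 5.5)] -/
theorem pFractionChi_add (hp : 0 < p) {x y : ℝ} (hx : IsPFraction p x) (hy : IsPFraction p y) :
    pFractionChi p (x + y) = pFractionChi p x + pFractionChi p y := by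
  obtain ⟨a, m, rfl⟩ := hx
  obtain ⟨b, n, rfl⟩ := hy
  have hp0 : (p : ℝ) ≠ 0 := by exact_mod_cast hp.ne'
  have hsum : (a : ℝ) / (p : ℝ) ^ m + b / (p : ℝ) ^ n =
      ((a * p ^ n + b * p ^ m : ℤ) : ℝ) / (p : ℝ) ^ (m + n) := by
    push_cast
    rw [pow_add]
    field_simp
  rw [pFractionChi_eq hp hsum, pFractionChi_eq hp rfl, pFractionChi_eq hp rfl]
  push_cast
  rw [natCast_p_zmod_pred hp, one_pow, one_pow, mul_one, mul_one]

/-- `χ(-x) = -χ(x)`. [folklore] -/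
theorem pFractionChi_neg (hp : 0 < p) (x : ℝ) : pFractionChi p (-x) = -pFractionChi p x := by
  by_cases hx : IsPFraction p x
  · obtain ⟨a, n, rfl⟩ := hx
    rw [pFractionChi_eq hp rfl, pFractionChi_eq hp (a := -a) (n := n) (by push_cast; ring)]
    push_cast
    ring
  · have hx' : ¬ IsPFraction p (-x) := fun h ↦ hx (by simpa using h.neg)
    rw [pFractionChi_of_not hx, pFractionChi_of_not hx', neg_zero]

/-- `χ(x - y) = χ(x) - χ(y)` on `H_p`. [folklore] -/
theorem pFractionChi_sub (hp : 0 < p) {x y : ℝ} (hx : IsPFraction p x) (hy : IsPFraction p y) :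
    pFractionChi p (x - y) = pFractionChi p x - pFractionChi p y := by
  rw [sub_eq_add_neg, pFractionChi_add hp hx hy.neg, pFractionChi_neg hp, sub_eq_add_neg]

/-- `χ(x/p) = χ(x)` for every real `x` (`p ≡ 1`; off `H_p` both sides are the junk value `0`).
[cite: ConnesConsani2017ScalingSite, Prop. 5.5 (ii) proof ("χ(p h) = χ(h)")] -/
theorem pFractionChi_div_p (hp : 0 < p) (x : ℝ) : pFractionChi p (x / p) = pFractionChi p x := by
  by_cases hx : IsPFraction p x
  · obtain ⟨a, n, rfl⟩ := hx
    rw [pFractionChi_eq hp rfl, pFractionChi_eq hp (a := a) (n := n + 1) (by rw [pow_succ]; ring)]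
  · rw [pFractionChi_of_not hx, pFractionChi_of_not (mt (isPFraction_div_p_iff hp.ne').1 hx)]

/-- `χ(px) = χ(x)` for every real `x`. [cite: ConnesConsani2017ScalingSite, Prop. 5.5 (ii) proof] -/
theorem pFractionChi_mul_p (hp : 0 < p) (x : ℝ) : pFractionChi p (p * x) = pFractionChi p x := by
  have hp0 : (p : ℝ) ≠ 0 := by exact_mod_cast hp.ne'
  have := pFractionChi_div_p hp (p * x)
  rw [mul_div_cancel_left₀ _ hp0] at this
  exact this.symm

/-- `χ` of an integer. [folklore] -/
theorem pFractionChi_intCast (hp : 0 < p) (a : ℤ) : pFractionChi p (a : ℝ) = (a : ZMod (p - 1)) :=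
  pFractionChi_eq hp (n := 0) (by simp)

/-- `χ(0) = 0`. [folklore] -/
theorem pFractionChi_zero (hp : 0 < p) : pFractionChi p 0 = 0 := by
  simpa using pFractionChi_intCast hp 0

end HpChi

/-! ### One-sided derivatives of piecewise-affine functions -/

section OneSided

/-- If `f` is affine of slope `s` on `[x, x + δ]` then its right derivative at `x` is `s`. [folklore] -/
theorem hasDerivWithinAt_Ioi_of_affine {f : ℝ → ℝ} {x δ s c : ℝ} (hδ : 0 < δ)
    (hf : ∀ t, x ≤ t → t ≤ x + δ → f t = c + s * (t - x)) : HasDerivWithinAt f s (Ioi x) x := by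
  have haff : HasDerivWithinAt (fun t ↦ c + s * (t - x)) s (Ioi x) x := by
    have h := ((hasDerivAt_id x).sub_const x).const_mul s |>.const_add c
    simpa using h.hasDerivWithinAt
  refine haff.congr_of_eventuallyEq ?_ (by rw [hf x le_rfl (by linarith)])
  filter_upwards [Ioo_mem_nhdsGT (show x < x + δ by linarith)] with t ht
  exact hf t ht.1.le ht.2.le

/-- If `f` is affine of slope `s` on `[x - δ, x]` then its left derivative at `x` is `s`. [folklore] -/
theorem hasDerivWithinAt_Iio_of_affine {f : ℝ → ℝ} {x δ s c x₀ : ℝ} (hδ : 0 < δ)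
    (hf : ∀ t, x - δ ≤ t → t ≤ x → f t = c + s * (t - x₀)) : HasDerivWithinAt f s (Iio x) x := by
  have haff : HasDerivWithinAt (fun t ↦ c + s * (t - x₀)) s (Iio x) x := by
    have h := ((hasDerivAt_id x).sub_const x₀).const_mul s |>.const_add c
    simpa using h.hasDerivWithinAt
  refine haff.congr_of_eventuallyEq ?_ (by rw [hf x (by linarith) le_rfl])
  filter_upwards [Ioo_mem_nhdsLT (show x - δ < x by linarith)] with t ht
  exact hf t ht.1.le ht.2.le

/-- **Slopes under the periodicity** (§5.4: "the slope `h_±(pλ)` of `f` at `pλ` is `h_±(λ)/p`"),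
right version, for any scaling `c > 0` with `f(ct) = f(t)` on `(0, ∞)`. [cite: ConnesConsani2017ScalingSite, §5.4 (before Def. 5.14)] -/
theorem hasDerivWithinAt_Ioi_scale {f : ℝ → ℝ} {c : ℝ} (hc : 0 < c)
    (hper : ∀ t, 0 < t → f (c * t) = f t) {x s : ℝ} (hx : 0 < x)
    (h : HasDerivWithinAt f s (Ioi x) x) : HasDerivWithinAt f (s / c) (Ioi (c * x)) (c * x) := by
  have hg : HasDerivWithinAt (fun t : ℝ ↦ t / c) (1 / c) (Ioi (c * x)) (c * x) := by
    have := (hasDerivAt_id (c * x)).div_const c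
    simpa using this.hasDerivWithinAt
  have hgx : (c * x) / c = x := by field_simp
  have hmaps : MapsTo (fun t : ℝ ↦ t / c) (Ioi (c * x)) (Ioi x) := by
    intro t ht
    simp only [mem_Ioi] at ht ⊢
    rw [lt_div_iff₀ hc]; linarith
  have h' : HasDerivWithinAt f s (Ioi x) ((c * x) / c) := by rw [hgx]; exact h
  have hcomp := h'.comp (c * x) hg hmaps
  have heq : s * (1 / c) = s / c := by ring
  rw [heq] at hcomp
  refine hcomp.congr_of_eventuallyEq ?_ ?_
  · filter_upwards [self_mem_nhdsWithin] with t (ht : c * x < t)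
    have htc : 0 < t / c := div_pos (by nlinarith) hc
    show f t = f (t / c)
    rw [← hper (t / c) htc, mul_div_cancel₀ _ hc.ne']
  · show f (c * x) = f ((c * x) / c)
    rw [hgx, hper x hx]

/-- Slopes under the periodicity, left version. [cite: ConnesConsani2017ScalingSite, §5.4 (before Def. 5.14)] -/
theorem hasDerivWithinAt_Iio_scale {f : ℝ → ℝ} {c : ℝ} (hc : 0 < c)
    (hper : ∀ t, 0 < t → f (c * t) = f t) {x s : ℝ} (hx : 0 < x)
    (h : HasDerivWithinAt f s (Iio x) x) : HasDerivWithinAt f (s / c) (Iio (c * x)) (c * x) := by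
  have hg : HasDerivWithinAt (fun t : ℝ ↦ t / c) (1 / c) (Iio (c * x)) (c * x) := by
    have := (hasDerivAt_id (c * x)).div_const c
    simpa using this.hasDerivWithinAt
  have hgx : (c * x) / c = x := by field_simp
  have hmaps : MapsTo (fun t : ℝ ↦ t / c) (Iio (c * x)) (Iio x) := by
    intro t ht
    simp only [mem_Iio] at ht ⊢
    rw [div_lt_iff₀ hc]; linarith
  have h' : HasDerivWithinAt f s (Iio x) ((c * x) / c) := by rw [hgx]; exact h
  have hcomp := h'.comp (c * x) hg hmaps
  have heq : s * (1 / c) = s / c := by ring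
  rw [heq] at hcomp
  refine hcomp.congr_of_eventuallyEq ?_ ?_
  · filter_upwards [Ioo_mem_nhdsLT (show c * x / 2 < c * x by nlinarith)] with t ht
    have htc : 0 < t / c := div_pos (by nlinarith [ht.1]) hc
    show f t = f (t / c)
    rw [← hper (t / c) htc, mul_div_cancel₀ _ hc.ne']
  · show f (c * x) = f ((c * x) / c)
    rw [hgx, hper x hx]

/-- Iterating the periodicity: `f(p^k t) = f(t)` for `k ∈ ℤ`. [folklore] -/
theorem periodic_zpow {β : Type*} {f : ℝ → β} {p : ℕ} (hp : 0 < p)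
    (hper : ∀ t, 0 < t → f (p * t) = f t)
    (k : ℤ) (t : ℝ) (ht : 0 < t) : f ((p : ℝ) ^ k * t) = f t := by
  have hp0 : (0 : ℝ) < p := by exact_mod_cast hp
  have hnat : ∀ (m : ℕ) (u : ℝ), 0 < u → f ((p : ℝ) ^ m * u) = f u := by
    intro m
    induction m with
    | zero => intro u _; simp
    | succ m ih =>
      intro u hu
      rw [pow_succ, mul_comm ((p : ℝ) ^ m), mul_assoc, hper _ (by positivity), ih u hu]
  obtain ⟨m, rfl | rfl⟩ := k.eq_nat_or_neg
  · rw [zpow_natCast]; exact hnat m t ht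
  · rw [zpow_neg, zpow_natCast]
    have h := hnat m (((p : ℝ) ^ m)⁻¹ * t) (by positivity)
    rw [← mul_assoc, mul_inv_cancel₀ (by positivity), one_mul] at h
    exact h.symm

/-- **The order is a class function**: `Ord(f)(cλ) = Ord(f)(λ)` whenever `f(ct) = f(t)` and `f`
has one-sided derivatives at `λ > 0`. [cite: ConnesConsani2017ScalingSite, §5.4 (before Def. 5.14)] -/
theorem cpOrder_scale {f : ℝ → ℝ} {c : ℝ} (hc : 0 < c) (hper : ∀ t, 0 < t → f (c * t) = f t)
    {x sR sL : ℝ} (hx : 0 < x) (hR : HasDerivWithinAt f sR (Ioi x) x)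
    (hL : HasDerivWithinAt f sL (Iio x) x) : cpOrder f (c * x) = cpOrder f x := by
  unfold cpOrder
  rw [(hasDerivWithinAt_Ioi_scale hc hper hx hR).derivWithin (uniqueDiffWithinAt_Ioi _),
    (hasDerivWithinAt_Iio_scale hc hper hx hL).derivWithin (uniqueDiffWithinAt_Iio _),
    hR.derivWithin (uniqueDiffWithinAt_Ioi _), hL.derivWithin (uniqueDiffWithinAt_Iio _)]
  field_simp

end OneSided


/-! ### Piece data of `f ∈ 𝒦(C_p)`, `ℕ`-indexed -/

/-- `ℕ`-indexed piece data for a rational function on `C_p` (proof of Prop. 5.4 (v): "Let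
`λ₀ < λ₁ < … < λ_{n-1} < λ_n = pλ₀` be a finite sequence of positive real numbers such that `f` is
affine with slope `h_j ∈ H_p` on the interval `I_j = [λ_{j-1}, λ_j]`"): breakpoints
`lam 0 < lam 1 < ⋯ < lam (n+1) = p · lam 0` and slopes `h 0, …, h n`, `f` affine of slope `h j` on
`[lam j, lam (j+1)]`. [cite: ConnesConsani2017ScalingSite, proof of Prop. 5.4 (v)] -/
structure CpPieces (p : ℕ) (f : ℝ → ℝ) where
  /-- number of pieces minus one -/
  n : ℕ
  /-- breakpoints `lam 0, …, lam (n+1)` (later values irrelevant) -/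
  lam : ℕ → ℝ
  /-- slopes `h 0, …, h n` (later values irrelevant) -/
  h : ℕ → ℝ
  lam_pos : 0 < lam 0
  lam_lt : ∀ i, i ≤ n → lam i < lam (i + 1)
  lam_last : lam (n + 1) = p * lam 0
  h_mem : ∀ j, j ≤ n → IsPFraction p (h j)
  piece : ∀ j, j ≤ n → ∀ x, lam j ≤ x → x ≤ lam (j + 1) → f x = f (lam j) + h j * (x - lam j)

/-- A rational function has piece data. [folklore] -/
theorem IsCpRational.nonempty_cpPieces {p : ℕ} {f : ℝ → ℝ} (hf : IsCpRational p f) :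
    Nonempty (CpPieces p f) := by
  obtain ⟨-, n, lam, h, h0, hmono, hlast, hmem, hpiece⟩ := hf
  refine ⟨{ n := n
            lam := fun i ↦ if hi : i < n + 2 then lam ⟨i, hi⟩ else 0
            h := fun j ↦ if hj : j < n + 1 then h ⟨j, hj⟩ else 0
            lam_pos := by simpa using h0
            lam_lt := ?_
            lam_last := ?_
            h_mem := ?_
            piece := ?_ }⟩
  · intro i hi
    have h1 : i < n + 2 := by omega
    have h2 : i + 1 < n + 2 := by omega
    simp only [h1, h2, dif_pos]
    exact hmono (Fin.mk_lt_mk.2 (Nat.lt_succ_self i))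
  · have h1 : n + 1 < n + 2 := by omega
    simp only [h1, dif_pos, show (0 : ℕ) < n + 2 by omega]
    exact hlast
  · intro j hj
    have h1 : j < n + 1 := by omega
    simp only [h1, dif_pos]
    exact hmem _
  · intro j hj x hx1 hx2
    have h1 : j < n + 1 := by omega
    have h2 : j < n + 2 := by omega
    have h3 : j + 1 < n + 2 := by omega
    simp only [h1, h2, h3, dif_pos] at hx1 hx2 ⊢
    exact hpiece ⟨j, h1⟩ x hx1 hx2

namespace CpPieces

variable {p : ℕ} {f : ℝ → ℝ} (P : CpPieces p f)

/-- Monotonicity of the breakpoints. [folklore] -/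
theorem lam_lt_of_lt {i j : ℕ} (hij : i < j) (hj : j ≤ P.n + 1) : P.lam i < P.lam j := by
  induction j with
  | zero => exact absurd hij (Nat.not_lt_zero _)
  | succ j ih =>
    rcases Nat.lt_succ_iff_lt_or_eq.1 hij with h | h
    · exact (ih h (by omega)).trans (P.lam_lt j (by omega))
    · rw [h]; exact P.lam_lt j (by omega)

/-- Monotonicity of the breakpoints (weak). [folklore] -/
theorem lam_le_of_le {i j : ℕ} (hij : i ≤ j) (hj : j ≤ P.n + 1) : P.lam i ≤ P.lam j := by
  rcases hij.eq_or_lt with h | h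
  · rw [h]
  · exact (P.lam_lt_of_lt h hj).le

/-- All breakpoints are positive. [folklore] -/
theorem lam_pos' {i : ℕ} (hi : i ≤ P.n + 1) : 0 < P.lam i :=
  P.lam_pos.trans_le (P.lam_le_of_le (Nat.zero_le i) hi)

/-- The breakpoints are injective on `{0, …, n+1}`. [folklore] -/
theorem lam_injOn : Set.InjOn P.lam {i | i ≤ P.n + 1} := by
  intro i hi j hj hij
  by_contra hne
  rcases Nat.lt_or_gt_of_ne hne with h | h
  · exact (P.lam_lt_of_lt h hj).ne hij
  · exact (P.lam_lt_of_lt h hi).ne hij.symm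

/-- `f(λ_{j+1}) - f(λ_j) = h_j (λ_{j+1} - λ_j)`. [folklore] -/
theorem f_lam_succ {j : ℕ} (hj : j ≤ P.n) :
    f (P.lam (j + 1)) = f (P.lam j) + P.h j * (P.lam (j + 1) - P.lam j) :=
  P.piece j hj _ (P.lam_lt j hj).le le_rfl

/-- Telescoping: `Σ_j h_j (λ_{j+1} - λ_j) = f(λ_{n+1}) - f(λ_0)`. [folklore] -/
theorem sum_h_mul_eq :
    ∑ j ∈ Finset.range (P.n + 1), P.h j * (P.lam (j + 1) - P.lam j) =
      f (P.lam (P.n + 1)) - f (P.lam 0) := by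
  rw [← Finset.sum_range_sub (fun j ↦ f (P.lam j)) (P.n + 1)]
  refine Finset.sum_congr rfl fun j hj ↦ ?_
  rw [P.f_lam_succ (by simpa [Finset.mem_range, Nat.lt_succ_iff] using hj)]
  ring

/-- Right derivative on `[λ_j, λ_{j+1})`: slope `h_j`. [folklore] -/
theorem hasDerivWithinAt_Ioi {j : ℕ} (hj : j ≤ P.n) {y : ℝ} (h1 : P.lam j ≤ y)
    (h2 : y < P.lam (j + 1)) : HasDerivWithinAt f (P.h j) (Ioi y) y :=
  hasDerivWithinAt_Ioi_of_affine (δ := P.lam (j + 1) - y) (c := f (P.lam j) + P.h j * (y - P.lam j))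
    (by linarith) fun t ht1 ht2 ↦ by
      rw [P.piece j hj t (by linarith) (by linarith)]; ring

/-- Left derivative on `(λ_j, λ_{j+1}]`: slope `h_j`. [folklore] -/
theorem hasDerivWithinAt_Iio {j : ℕ} (hj : j ≤ P.n) {y : ℝ} (h1 : P.lam j < y)
    (h2 : y ≤ P.lam (j + 1)) : HasDerivWithinAt f (P.h j) (Iio y) y :=
  hasDerivWithinAt_Iio_of_affine (δ := y - P.lam j) (c := f (P.lam j)) (x₀ := P.lam j)
    (by linarith) fun t ht1 ht2 ↦ P.piece j hj t (by linarith) (by linarith)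

/-- Left derivative at `λ_0` is `p h_n` (periodicity: "`ph_n` is the slope of the function `f` in
the interval `(1/p) I_n`"). [cite: ConnesConsani2017ScalingSite, proof of Prop. 5.4 (v)] -/
theorem hasDerivWithinAt_Iio_zero (hp : 0 < p) (hper : ∀ t, 0 < t → f (p * t) = f t) :
    HasDerivWithinAt f (p * P.h P.n) (Iio (P.lam 0)) (P.lam 0) := by
  have hp0 : (0 : ℝ) < p := by exact_mod_cast hp
  have h1 : HasDerivWithinAt f (P.h P.n) (Iio (P.lam (P.n + 1))) (P.lam (P.n + 1)) :=
    P.hasDerivWithinAt_Iio le_rfl (P.lam_lt _ le_rfl) le_rfl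
  rw [P.lam_last] at h1
  have hper' : ∀ t, 0 < t → f ((p : ℝ)⁻¹ * t) = f t := fun t ht ↦ by
    have := hper ((p : ℝ)⁻¹ * t) (by positivity)
    rw [← mul_assoc, mul_inv_cancel₀ hp0.ne', one_mul] at this
    exact this.symm
  have h2 := hasDerivWithinAt_Iio_scale (c := (p : ℝ)⁻¹) (by positivity) hper'
    (x := p * P.lam 0) (by have := P.lam_pos; positivity) h1
  have e1 : (p : ℝ)⁻¹ * (p * P.lam 0) = P.lam 0 := by field_simp
  have e2 : P.h P.n / (p : ℝ)⁻¹ = p * P.h P.n := by rw [div_inv_eq_mul, mul_comm]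
  rw [e1, e2] at h2
  exact h2

/-- Locating the piece containing `y` (to the right). [folklore] -/
theorem exists_piece_right {y : ℝ} (h0 : P.lam 0 ≤ y) (h1 : y < P.lam (P.n + 1)) :
    ∃ j, j ≤ P.n ∧ P.lam j ≤ y ∧ y < P.lam (j + 1) := by
  classical
  set j := Nat.findGreatest (fun i ↦ P.lam i ≤ y) P.n with hjdef
  have hj : P.lam j ≤ y := Nat.findGreatest_spec (P := fun i ↦ P.lam i ≤ y) (Nat.zero_le _) h0
  refine ⟨j, Nat.findGreatest_le _, hj, ?_⟩
  by_contra hcon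
  push Not at hcon
  have hjn : j ≤ P.n := Nat.findGreatest_le _
  have hj1 : j + 1 ≤ P.n := by
    rcases Nat.lt_or_ge j P.n with h | h
    · omega
    · have : j = P.n := le_antisymm hjn h
      rw [this] at hcon
      linarith
  have := Nat.le_findGreatest (P := fun i ↦ P.lam i ≤ y) hj1 hcon
  omega

/-- Locating the piece containing `y` (to the left). [folklore] -/
theorem exists_piece_left {y : ℝ} (h0 : P.lam 0 < y) (h1 : y ≤ P.lam (P.n + 1)) :
    ∃ j, j ≤ P.n ∧ P.lam j < y ∧ y ≤ P.lam (j + 1) := by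
  classical
  set j := Nat.findGreatest (fun i ↦ P.lam i < y) P.n with hjdef
  have hj : P.lam j < y := Nat.findGreatest_spec (P := fun i ↦ P.lam i < y) (Nat.zero_le _) h0
  refine ⟨j, Nat.findGreatest_le _, hj, ?_⟩
  by_contra hcon
  push Not at hcon
  have hjn : j ≤ P.n := Nat.findGreatest_le _
  have hj1 : j + 1 ≤ P.n := by
    rcases Nat.lt_or_ge j P.n with h | h
    · omega
    · have : j = P.n := le_antisymm hjn h
      rw [this] at hcon
      linarith
  have := Nat.le_findGreatest (P := fun i ↦ P.lam i < y) hj1 hcon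
  omega

/-- One-sided derivatives exist at every point of the period `[λ_0, λ_{n+1})`. [folklore] -/
theorem exists_hasDerivWithinAt (hp : 0 < p) (hper : ∀ t, 0 < t → f (p * t) = f t) {y : ℝ}
    (h0 : P.lam 0 ≤ y) (h1 : y < P.lam (P.n + 1)) :
    ∃ sR sL : ℝ, HasDerivWithinAt f sR (Ioi y) y ∧ HasDerivWithinAt f sL (Iio y) y := by
  obtain ⟨j, hj, hy1, hy2⟩ := P.exists_piece_right h0 h1
  have hR := P.hasDerivWithinAt_Ioi hj hy1 hy2
  rcases h0.eq_or_lt with h | h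
  · refine ⟨P.h j, p * P.h P.n, hR, ?_⟩
    rw [← h]
    exact P.hasDerivWithinAt_Iio_zero hp hper
  · obtain ⟨i, hi, hy3, hy4⟩ := P.exists_piece_left h h1.le
    exact ⟨P.h j, P.h i, hR, P.hasDerivWithinAt_Iio hi hy3 hy4⟩

/-- The order vanishes in the interior of a piece. [cite: ConnesConsani2017ScalingSite, proof of Prop. 5.4 (v)] -/
theorem cpOrder_of_mem_Ioo {j : ℕ} (hj : j ≤ P.n) {y : ℝ} (h1 : P.lam j < y)
    (h2 : y < P.lam (j + 1)) : cpOrder f y = 0 := by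
  unfold cpOrder
  rw [(P.hasDerivWithinAt_Ioi hj h1.le h2).derivWithin (uniqueDiffWithinAt_Ioi _),
    (P.hasDerivWithinAt_Iio hj h1 h2.le).derivWithin (uniqueDiffWithinAt_Iio _)]
  ring

/-- The order at an interior breakpoint: `Order(f)(λ_i) = λ_i (h_i - h_{i-1})` (`1 ≤ i ≤ n`; here
`i = j + 1`). [cite: ConnesConsani2017ScalingSite, proof of Prop. 5.4 (v)] -/
theorem cpOrder_lam_succ {j : ℕ} (hj : j + 1 ≤ P.n) :
    cpOrder f (P.lam (j + 1)) = P.lam (j + 1) * (P.h (j + 1) - P.h j) := by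
  unfold cpOrder
  rw [(P.hasDerivWithinAt_Ioi hj le_rfl (P.lam_lt _ hj)).derivWithin (uniqueDiffWithinAt_Ioi _),
    (P.hasDerivWithinAt_Iio (by omega) (P.lam_lt j (by omega)) le_rfl).derivWithin
      (uniqueDiffWithinAt_Iio _)]

/-- The order at `λ_0`: `Order(f)(λ_0) = λ_0 (h_0 - p h_n)` (the source's "`λ_0(h_1 - ph_n)`" in its
`1`-based numbering). [cite: ConnesConsani2017ScalingSite, proof of Prop. 5.4 (v)] -/
theorem cpOrder_lam_zero (hp : 0 < p) (hper : ∀ t, 0 < t → f (p * t) = f t) :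
    cpOrder f (P.lam 0) = P.lam 0 * (P.h 0 - p * P.h P.n) := by
  unfold cpOrder
  rw [(P.hasDerivWithinAt_Ioi (Nat.zero_le _) le_rfl (P.lam_lt 0 (Nat.zero_le _))).derivWithin
      (uniqueDiffWithinAt_Ioi _),
    (P.hasDerivWithinAt_Iio_zero hp hper).derivWithin (uniqueDiffWithinAt_Iio _)]

/-- In a period, the order is supported on the breakpoints. [folklore] -/
theorem eq_lam_of_cpOrder_ne_zero {y : ℝ} (h0 : P.lam 0 ≤ y) (h1 : y < P.lam (P.n + 1))
    (hy : cpOrder f y ≠ 0) : ∃ j, j ≤ P.n ∧ y = P.lam j := by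
  obtain ⟨j, hj, hy1, hy2⟩ := P.exists_piece_right h0 h1
  rcases hy1.eq_or_lt with h | h
  · exact ⟨j, hj, h.symm⟩
  · exact absurd (P.cpOrder_of_mem_Ioo hj h hy2) hy

/-- The order is a class function: `Order(f)(p^k λ) = Order(f)(λ)` for `λ` in the period.
[cite: ConnesConsani2017ScalingSite, §5.4 (before Def. 5.14)] -/
theorem cpOrder_zpow_mul (hp : 0 < p) (hper : ∀ t, 0 < t → f (p * t) = f t) {y : ℝ}
    (h0 : P.lam 0 ≤ y) (h1 : y < P.lam (P.n + 1)) (k : ℤ) :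
    cpOrder f ((p : ℝ) ^ k * y) = cpOrder f y := by
  have hp0 : (0 : ℝ) < p := by exact_mod_cast hp
  obtain ⟨sR, sL, hR, hL⟩ := P.exists_hasDerivWithinAt hp hper h0 h1
  exact cpOrder_scale (zpow_pos hp0 k) (periodic_zpow hp hper k) (P.lam_pos.trans_le h0) hR hL

end CpPieces

/-! ### Reduction to a fundamental domain -/

/-- Every `x > 0` is `p^k y` with `y` in a prescribed fundamental domain `[c, pc)`. [folklore] -/
theorem exists_zpow_mul_mem_Ico {p : ℕ} (hp : 1 < p) {c : ℝ} (hc : 0 < c) {x : ℝ} (hx : 0 < x) :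
    ∃ (k : ℤ) (y : ℝ), c ≤ y ∧ y < p * c ∧ x = (p : ℝ) ^ k * y := by
  have hp0 : (0 : ℝ) < p := by exact_mod_cast (zero_lt_one.trans hp)
  set k : ℤ := Int.log p (x / c) with hk
  have h1 : (p : ℝ) ^ k ≤ x / c := Int.zpow_log_le_self hp (div_pos hx hc)
  have h2 : x / c < (p : ℝ) ^ (k + 1) := Int.lt_zpow_succ_log_self hp (x / c)
  have hpk : (0 : ℝ) < (p : ℝ) ^ k := zpow_pos hp0 k
  refine ⟨k, x / (p : ℝ) ^ k, ?_, ?_, ?_⟩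
  · rw [le_div_iff₀ hpk]
    rw [le_div_iff₀ hc] at h1
    linarith
  · rw [div_lt_iff₀ hpk]
    rw [div_lt_iff₀ hc, zpow_add_one₀ hp0.ne'] at h2
    linarith
  · rw [mul_div_cancel₀ _ hpk.ne']

/-- **Sums of a class function over a fundamental domain do not depend on the domain**, step 1:
`[c, pc)` versus `[1, p)` for `c ∈ [1, p)`. [folklore] -/
theorem finsum_Ico_eq_of_periodic_aux {M : Type*} [AddCommMonoid M] {p : ℕ} (hp : 1 < p)
    (g : ℝ → M) (hg : ∀ x, 0 < x → g (p * x) = g x) {c : ℝ} (hc1 : 1 ≤ c) (hcp : c < p)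
    (hfin : (Ico c (p * c) ∩ Function.support g).Finite) :
    (Ico 1 (p : ℝ) ∩ Function.support g).Finite ∧
      ∑ᶠ x ∈ Ico 1 (p : ℝ), g x = ∑ᶠ x ∈ Ico c (p * c), g x := by
  have hp0 : (0 : ℝ) < p := by exact_mod_cast (zero_lt_one.trans hp)
  have hc0 : 0 < c := zero_lt_one.trans_le hc1
  -- the pieces
  have hA : (Ico c (p : ℝ) ∩ Function.support g).Finite :=
    hfin.subset (inter_subset_inter_left _ (Ico_subset_Ico_right (by nlinarith)))
  have hB : (Ico (p : ℝ) (p * c) ∩ Function.support g).Finite :=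
    hfin.subset (inter_subset_inter_left _ (Ico_subset_Ico_left hcp.le))
  have hbij : BijOn (fun x : ℝ ↦ (p : ℝ) * x) (Ico 1 c) (Ico (p : ℝ) (p * c)) := by
    refine ⟨fun x hx ↦ ⟨by nlinarith [hx.1], by nlinarith [hx.2]⟩, fun x _ y _ h ↦ ?_, fun y hy ↦ ?_⟩
    · exact mul_left_cancel₀ hp0.ne' h
    · refine ⟨y / p, ⟨?_, ?_⟩, by simp [mul_div_cancel₀ _ hp0.ne']⟩
      · rw [le_div_iff₀ hp0]; linarith [hy.1]
      · rw [div_lt_iff₀ hp0]; linarith [hy.2]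
  have hC : (Ico 1 c ∩ Function.support g).Finite := by
    refine (hB.preimage (f := fun x : ℝ ↦ (p : ℝ) * x) fun x _ y _ h ↦
      mul_left_cancel₀ hp0.ne' h).subset fun x hx ↦ ?_
    refine ⟨hbij.1 hx.1, ?_⟩
    rw [Function.mem_support, hg x (zero_lt_one.trans_le hx.1.1)]
    exact hx.2
  have hsumC : ∑ᶠ x ∈ Ico 1 c, g x = ∑ᶠ x ∈ Ico (p : ℝ) (p * c), g x :=
    finsum_mem_eq_of_bijOn _ hbij fun x hx ↦ (hg x (zero_lt_one.trans_le hx.1)).symm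
  have hU1 : Ico 1 (p : ℝ) = Ico 1 c ∪ Ico c p := (Ico_union_Ico_eq_Ico hc1 hcp.le).symm
  have hU2 : Ico c (p * c) = Ico c p ∪ Ico (p : ℝ) (p * c) :=
    (Ico_union_Ico_eq_Ico hcp.le (by nlinarith)).symm
  refine ⟨?_, ?_⟩
  · rw [hU1, union_inter_distrib_right]
    exact hC.union hA
  · rw [hU1, hU2, finsum_mem_union' (Ico_disjoint_Ico_same) hC hA,
      finsum_mem_union' (Ico_disjoint_Ico_same) hA hB, hsumC, add_comm]

/-- **Sums of a class function over a fundamental domain** `[c, pc)` equal the sum over `[1, p)`, for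
every `c > 0` (invariance `g(px) = g(x)`; finite support on `[c, pc)`). [folklore] -/
theorem finsum_Ico_eq_of_periodic {M : Type*} [AddCommMonoid M] {p : ℕ} (hp : 1 < p)
    (g : ℝ → M) (hg : ∀ x, 0 < x → g (p * x) = g x) {c : ℝ} (hc : 0 < c)
    (hfin : (Ico c (p * c) ∩ Function.support g).Finite) :
    (Ico 1 (p : ℝ) ∩ Function.support g).Finite ∧
      ∑ᶠ x ∈ Ico 1 (p : ℝ), g x = ∑ᶠ x ∈ Ico c (p * c), g x := by
  have hp0 : (0 : ℝ) < p := by exact_mod_cast (zero_lt_one.trans hp)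
  have hp' : 0 < p := zero_lt_one.trans hp
  -- `c = p^k c₀`, `c₀ ∈ [1, p)`
  obtain ⟨k, c₀, hc₀1, hc₀p, hck⟩ := exists_zpow_mul_mem_Ico hp zero_lt_one hc
  rw [mul_one] at hc₀p
  have hpk : (0 : ℝ) < (p : ℝ) ^ k := zpow_pos hp0 k
  have hbij : BijOn (fun x : ℝ ↦ (p : ℝ) ^ k * x) (Ico c₀ (p * c₀)) (Ico c (p * c)) := by
    refine ⟨fun x hx ↦ ⟨?_, ?_⟩, fun x _ y _ h ↦ mul_left_cancel₀ hpk.ne' h, fun y hy ↦ ?_⟩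
    · rw [hck]; exact mul_le_mul_of_nonneg_left hx.1 hpk.le
    · rw [hck]; nlinarith [hx.2]
    · refine ⟨y / (p : ℝ) ^ k, ⟨?_, ?_⟩, by simp [mul_div_cancel₀ _ hpk.ne']⟩
      · rw [le_div_iff₀ hpk]; rw [hck] at hy; linarith [hy.1]
      · rw [div_lt_iff₀ hpk]; rw [hck] at hy; linarith [hy.2]
  have hgk : ∀ x, 0 < x → g ((p : ℝ) ^ k * x) = g x := fun x hx ↦ periodic_zpow hp' hg k x hx
  have hfin₀ : (Ico c₀ (p * c₀) ∩ Function.support g).Finite := by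
    refine (hfin.preimage (f := fun x : ℝ ↦ (p : ℝ) ^ k * x) fun x _ y _ h ↦
      mul_left_cancel₀ hpk.ne' h).subset fun x hx ↦ ?_
    refine ⟨hbij.1 hx.1, ?_⟩
    rw [Function.mem_support, hgk x (zero_lt_one.trans_le (hc₀1.trans hx.1.1))]
    exact hx.2
  have hsum : ∑ᶠ x ∈ Ico c₀ (p * c₀), g x = ∑ᶠ x ∈ Ico c (p * c), g x :=
    finsum_mem_eq_of_bijOn _ hbij fun x hx ↦ (hgk x (zero_lt_one.trans_le (hc₀1.trans hx.1))).symm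
  obtain ⟨h1, h2⟩ := finsum_Ico_eq_of_periodic_aux hp g hg hc₀1 hc₀p hfin₀
  exact ⟨h1, h2.trans hsum⟩


/-! ### Prop. 5.4 (v) `Σ ord = 0` and Prop. 5.5 (ii) `χ((f)) = 0` -/

/-- The Abel-summation identity behind Prop. 5.4 (v):
`λ_0 h_0 - λ_{n+1} h_n + Σ_{j<n} λ_{j+1}(h_{j+1} - h_j) = -Σ_{j ≤ n} h_j (λ_{j+1} - λ_j)`. [folklore] -/
theorem abel_identity (lam h : ℕ → ℝ) (n : ℕ) :
    lam 0 * h 0 - lam (n + 1) * h n + ∑ j ∈ Finset.range n, lam (j + 1) * (h (j + 1) - h j) =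
      -∑ j ∈ Finset.range (n + 1), h j * (lam (j + 1) - lam j) := by
  induction n with
  | zero => simp only [zero_add, Finset.range_zero, Finset.sum_empty, add_zero,
      Finset.sum_range_one]; ring
  | succ n ih =>
    rw [Finset.sum_range_succ, Finset.sum_range_succ (n := n + 1)]
    linear_combination ih

namespace CpPieces

variable {p : ℕ} {f : ℝ → ℝ} (P : CpPieces p f)

/-- The support of the order within a period is contained in the set of breakpoints. [folklore] -/
theorem support_cpOrder_subset :
    Ico (P.lam 0) (P.lam (P.n + 1)) ∩ Function.support (cpOrder f) ⊆
      ↑((Finset.range (P.n + 1)).image P.lam) := by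
  intro y hy
  obtain ⟨j, hj, rfl⟩ := P.eq_lam_of_cpOrder_ne_zero hy.1.1 hy.1.2 hy.2
  simp only [Finset.coe_image, Finset.coe_range, Set.mem_image, Set.mem_Iio]
  exact ⟨j, by omega, rfl⟩

/-- The breakpoints `λ_0, …, λ_n` lie in the period. [folklore] -/
theorem image_lam_subset :
    (↑((Finset.range (P.n + 1)).image P.lam) : Set ℝ) ⊆ Ico (P.lam 0) (P.lam (P.n + 1)) := by
  intro y hy
  simp only [Finset.coe_image, Finset.coe_range, Set.mem_image, Set.mem_Iio] at hy
  obtain ⟨j, hj, rfl⟩ := hy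
  exact ⟨P.lam_le_of_le (Nat.zero_le j) (by omega), P.lam_lt_of_lt hj le_rfl⟩

/-- The breakpoint map is injective on `range (n+1)`. [folklore] -/
theorem lam_injOn_range : Set.InjOn P.lam ↑(Finset.range (P.n + 1)) := fun i hi j hj h ↦
  P.lam_injOn (by simp only [Finset.coe_range, Set.mem_Iio] at hi; exact show i ≤ P.n + 1 by omega)
    (by simp only [Finset.coe_range, Set.mem_Iio] at hj; exact show j ≤ P.n + 1 by omega) h

/-- **Prop. 5.4 (v) on one period**: `Σ_{H} ord_H(f) = 0`, the sum over the breakpoints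
`λ_0, …, λ_n` (telescoping with `f(pλ_0) = f(λ_0)`). [cite: ConnesConsani2017ScalingSite, Prop. 5.4 (v)] -/
theorem finsum_cpOrder_period (hp : 0 < p) (hper : ∀ t, 0 < t → f (p * t) = f t) :
    ∑ᶠ y ∈ Ico (P.lam 0) (P.lam (P.n + 1)), cpOrder f y = 0 := by
  classical
  rw [finsum_mem_eq_sum_of_subset _ P.support_cpOrder_subset P.image_lam_subset,
    Finset.sum_image P.lam_injOn_range, Finset.sum_range_succ', P.cpOrder_lam_zero hp hper,
    Finset.sum_congr rfl fun j hj ↦ P.cpOrder_lam_succ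
      (show j + 1 ≤ P.n by simp only [Finset.mem_range] at hj; omega)]
  calc ∑ j ∈ Finset.range P.n, P.lam (j + 1) * (P.h (j + 1) - P.h j) +
        P.lam 0 * (P.h 0 - p * P.h P.n)
      = P.lam 0 * P.h 0 - P.lam (P.n + 1) * P.h P.n +
          ∑ j ∈ Finset.range P.n, P.lam (j + 1) * (P.h (j + 1) - P.h j) := by
        rw [P.lam_last]; ring
    _ = -∑ j ∈ Finset.range (P.n + 1), P.h j * (P.lam (j + 1) - P.lam j) := abel_identity _ _ _
    _ = 0 := by rw [P.sum_h_mul_eq, P.lam_last, hper _ P.lam_pos]; ring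

/-- The support of `χ(Order(f)(λ)/λ)` within a period lies in the breakpoints. [folklore] -/
theorem support_chi_cpOrder_subset (hp : 0 < p) :
    Ico (P.lam 0) (P.lam (P.n + 1)) ∩ Function.support (fun y ↦ pFractionChi p (cpOrder f y / y)) ⊆
      ↑((Finset.range (P.n + 1)).image P.lam) := by
  intro y hy
  refine P.support_cpOrder_subset ⟨hy.1, ?_⟩
  intro h0
  apply hy.2
  simp only [h0, zero_div, pFractionChi_zero hp]

/-- **Prop. 5.5 (ii) on one period**: `χ((f)) = Σ_H χ_H(ord_H f) = 0` (telescoping,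
`χ(p h_n) = χ(h_n)`). [cite: ConnesConsani2017ScalingSite, Prop. 5.5 (ii)] -/
theorem finsum_chi_cpOrder_period (hp : 0 < p) (hper : ∀ t, 0 < t → f (p * t) = f t) :
    ∑ᶠ y ∈ Ico (P.lam 0) (P.lam (P.n + 1)), pFractionChi p (cpOrder f y / y) = 0 := by
  classical
  have hp' : p ≠ 0 := hp.ne'
  rw [finsum_mem_eq_sum_of_subset _ (P.support_chi_cpOrder_subset hp) P.image_lam_subset,
    Finset.sum_image P.lam_injOn_range, Finset.sum_range_succ', P.cpOrder_lam_zero hp hper,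
    mul_div_cancel_left₀ _ P.lam_pos.ne',
    Finset.sum_congr rfl fun j hj ↦ show pFractionChi p (cpOrder f (P.lam (j + 1)) / P.lam (j + 1))
        = pFractionChi p (P.h (j + 1)) - pFractionChi p (P.h j) from by
      have hj' : j + 1 ≤ P.n := by simp only [Finset.mem_range] at hj; omega
      rw [P.cpOrder_lam_succ hj', mul_div_cancel_left₀ _ (P.lam_pos' (by omega)).ne',
        pFractionChi_sub hp (P.h_mem _ hj') (P.h_mem _ (by omega))],
    Finset.sum_range_sub (fun j ↦ pFractionChi p (P.h j)),
    pFractionChi_sub hp (P.h_mem 0 (Nat.zero_le _)) ((P.h_mem P.n le_rfl).mul_p),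
    pFractionChi_mul_p hp]
  ring

include P in
/-- The order of `f` is a class function on all of `(0, ∞)`. [cite: ConnesConsani2017ScalingSite, §5.4 (before Def. 5.14)] -/
theorem cpOrder_mul_p (hp : 1 < p) (hper : ∀ t, 0 < t → f (p * t) = f t) {x : ℝ} (hx : 0 < x) :
    cpOrder f (p * x) = cpOrder f x := by
  have hp' : 0 < p := zero_lt_one.trans hp
  have hp0 : (p : ℝ) ≠ 0 := by exact_mod_cast hp'.ne'
  obtain ⟨k, y, hy0, hy1, rfl⟩ := exists_zpow_mul_mem_Ico hp P.lam_pos hx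
  rw [← P.lam_last] at hy1
  rw [show (p : ℝ) * ((p : ℝ) ^ k * y) = (p : ℝ) ^ (k + 1) * y by rw [zpow_add_one₀ hp0]; ring,
    P.cpOrder_zpow_mul hp' hper hy0 hy1, P.cpOrder_zpow_mul hp' hper hy0 hy1]

/-- Every order `Order(f)(x)`, `x > 0`, equals an order at a point of the period. [folklore] -/
theorem exists_cpOrder_eq (hp : 1 < p) (hper : ∀ t, 0 < t → f (p * t) = f t) {x : ℝ}
    (hx : 0 < x) : ∃ (k : ℤ) (y : ℝ), P.lam 0 ≤ y ∧ y < P.lam (P.n + 1) ∧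
      x = (p : ℝ) ^ k * y ∧ cpOrder f x = cpOrder f y := by
  have hp' : 0 < p := zero_lt_one.trans hp
  obtain ⟨k, y, hy0, hy1, rfl⟩ := exists_zpow_mul_mem_Ico hp P.lam_pos hx
  rw [← P.lam_last] at hy1
  exact ⟨k, y, hy0, hy1, rfl, P.cpOrder_zpow_mul hp' hper hy0 hy1 k⟩

/-- Finite support of the order on the period `[λ_0, pλ_0)`. [folklore] -/
theorem finite_support_cpOrder :
    (Ico (P.lam 0) (p * P.lam 0) ∩ Function.support (cpOrder f)).Finite := by
  rw [← P.lam_last]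
  exact (Finset.finite_toSet _).subset P.support_cpOrder_subset

end CpPieces

/-- **Prop. 5.4 (v)** for `f ∈ 𝒦(C_p)` (`p > 1`): the orders of `f` summed over the fundamental domain
`[1, p)` vanish, and only finitely many are non-zero there. [cite: ConnesConsani2017ScalingSite, Prop. 5.4 (v)] -/
theorem IsCpRational.finsum_cpOrder_eq_zero {p : ℕ} (hp : 1 < p) {f : ℝ → ℝ}
    (hf : IsCpRational p f) :
    (Ico 1 (p : ℝ) ∩ Function.support (cpOrder f)).Finite ∧
      ∑ᶠ x ∈ Ico 1 (p : ℝ), cpOrder f x = 0 := by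
  have hp' : 0 < p := zero_lt_one.trans hp
  obtain ⟨P⟩ := hf.nonempty_cpPieces
  obtain ⟨hfin, hsum⟩ := finsum_Ico_eq_of_periodic hp (cpOrder f)
    (fun x hx ↦ P.cpOrder_mul_p hp hf.1 hx) P.lam_pos P.finite_support_cpOrder
  refine ⟨hfin, ?_⟩
  rw [hsum, ← P.lam_last]
  exact P.finsum_cpOrder_period hp' hf.1

/-- **Prop. 5.5 (ii)** for `f ∈ 𝒦(C_p)` (`p > 1`): `Σ_{λ ∈ [1,p)} χ(Order(f)(λ)/λ) = 0`, with finite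
support. [cite: ConnesConsani2017ScalingSite, Prop. 5.5 (ii)] -/
theorem IsCpRational.finsum_chi_cpOrder_eq_zero {p : ℕ} (hp : 1 < p) {f : ℝ → ℝ}
    (hf : IsCpRational p f) :
    (Ico 1 (p : ℝ) ∩ Function.support (fun x ↦ pFractionChi p (cpOrder f x / x))).Finite ∧
      ∑ᶠ x ∈ Ico 1 (p : ℝ), pFractionChi p (cpOrder f x / x) = 0 := by
  have hp' : 0 < p := zero_lt_one.trans hp
  have hp0 : (p : ℝ) ≠ 0 := by exact_mod_cast hp'.ne'
  obtain ⟨P⟩ := hf.nonempty_cpPieces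
  have hinv : ∀ x, 0 < x →
      pFractionChi p (cpOrder f (p * x) / (p * x)) = pFractionChi p (cpOrder f x / x) := by
    intro x hx
    rw [P.cpOrder_mul_p hp hf.1 hx, mul_comm (p : ℝ) x, ← div_div, pFractionChi_div_p hp']
  have hfinP : (Ico (P.lam 0) (p * P.lam 0) ∩
      Function.support (fun y ↦ pFractionChi p (cpOrder f y / y))).Finite := by
    rw [← P.lam_last]
    exact (Finset.finite_toSet _).subset (P.support_chi_cpOrder_subset hp')
  obtain ⟨hfin, hsum⟩ := finsum_Ico_eq_of_periodic hp _ hinv P.lam_pos hfinP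
  refine ⟨hfin, ?_⟩
  rw [hsum, ← P.lam_last]
  exact P.finsum_chi_cpOrder_period hp' hf.1

/-- The tree's fundamental domain `{x | 1 ≤ x ∧ x < p}` is `Ico 1 p`. [folklore] -/
theorem setOf_fundamentalDomain_eq (p : ℕ) : {x : ℝ | 1 ≤ x ∧ x < p} = Ico 1 (p : ℝ) := rfl

/-- **Theorem 5.6, the easy inclusion `𝒫 ⊆ Ker(deg, χ)`**: a principal divisor has degree `0`
(Prop. 5.4 (v)) and invariant `χ = 0` (Prop. 5.5 (ii)). [cite: ConnesConsani2017ScalingSite, Prop. 5.4 (v) and Prop. 5.5 (ii)] -/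
theorem CpDivisor.IsPrincipal.cpDeg_eq_zero_and_cpChi_eq_zero {p : ℕ} (hp : 1 < p)
    {D : CpDivisor p} (hD : D.IsPrincipal) : cpDeg D = 0 ∧ cpChi D = 0 := by
  obtain ⟨f, hf, hDf⟩ := hD
  constructor
  · unfold cpDeg
    rw [setOf_fundamentalDomain_eq,
      finsum_mem_congr rfl fun x hx ↦ hDf x (zero_lt_one.trans_le hx.1)]
    exact (hf.finsum_cpOrder_eq_zero hp).2
  · unfold cpChi
    rw [setOf_fundamentalDomain_eq,
      finsum_mem_congr rfl fun x hx ↦ show pFractionChi p (D.toFun x / x) =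
        pFractionChi p (cpOrder f x / x) by rw [hDf x (zero_lt_one.trans_le hx.1)]]
    exact (hf.finsum_chi_cpOrder_eq_zero hp).2

/-- **Lemma 5.13 (i)**: "If `deg(D) < 0` then `H⁰(D) = 0`" — `D + (f) ≥ 0` forces
`deg D = deg(D + (f)) ≥ 0`. [cite: ConnesConsani2017ScalingSite, Lemma 5.13 (i)] -/
theorem cpH0_eq_empty_of_cpDeg_neg {p : ℕ} (hp : 1 < p) {D : CpDivisor p} (hD : cpDeg D < 0) :
    cpH0 D = ∅ := by
  rw [Set.eq_empty_iff_forall_notMem]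
  rintro f ⟨hf, hpos⟩
  obtain ⟨hfin, hsum0⟩ := hf.finsum_cpOrder_eq_zero hp
  have hDfin : (Ico 1 (p : ℝ) ∩ Function.support D.toFun).Finite :=
    D.finite_support.subset fun x hx ↦ ⟨hx.1.1, hx.1.2, hx.2⟩
  have hge : 0 ≤ ∑ᶠ x ∈ Ico 1 (p : ℝ), (D.toFun x + cpOrder f x) :=
    finsum_nonneg fun x ↦ finsum_nonneg fun hx ↦ hpos x (zero_lt_one.trans_le hx.1)
  rw [finsum_mem_add_distrib' hDfin hfin, hsum0, add_zero] at hge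
  unfold cpDeg at hD
  rw [setOf_fundamentalDomain_eq] at hD
  linarith

/-! ## Thm. 5.6: divisors of degree `0` and `χ = 0` are principal; `(deg, χ)` is onto — appended 2026-08-19 (cc-1 gen 2)

The constructive half of Theorem 5.6 and Lemma 5.13 (ii), following the printed proofs: unique
representatives modulo `p^ℤ`, point divisors `P_λ`, sums of divisors, the function `f` with
prescribed divisor ("one defines the function `f` to be affine with slope `h_j` in the interval
`I_j = [λ_{j-1}, λ_j]` … extend `f` by periodicity", with `h_n = σ/(1-p)`). -/

section Construction

/-! ### Unique representatives modulo `p^ℤ` -/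

/-- Uniqueness of the representation `x = p^k y`, `y ∈ [c, pc)`. [folklore] -/
theorem zpow_mul_eq_zpow_mul_iff {p : ℕ} (hp : 1 < p) {c : ℝ} (hc : 0 < c) {k k' : ℤ} {y y' : ℝ}
    (hy : c ≤ y) (hy' : y < p * c) (hz : c ≤ y') (hz' : y' < p * c)
    (h : (p : ℝ) ^ k * y = (p : ℝ) ^ k' * y') : k = k' ∧ y = y' := by
  have hp0 : (0 : ℝ) < p := by exact_mod_cast (zero_lt_one.trans hp)
  have hp1 : (1 : ℝ) ≤ p := by exact_mod_cast hp.le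
  have key : ∀ {k k' : ℤ} {y y' : ℝ}, c ≤ y → y < p * c → c ≤ y' →
      (p : ℝ) ^ k * y = (p : ℝ) ^ k' * y' → ¬ k < k' := by
    intro k k' y y' hy hy' hz h hlt
    have hd : (1 : ℤ) ≤ k' - k := by omega
    have hge : (p : ℝ) ≤ (p : ℝ) ^ (k' - k) := by
      calc (p : ℝ) = (p : ℝ) ^ (1 : ℤ) := (zpow_one _).symm
        _ ≤ (p : ℝ) ^ (k' - k) := zpow_le_zpow_right₀ hp1 hd
    have hpk : (0 : ℝ) < (p : ℝ) ^ k := zpow_pos hp0 k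
    have hy_eq : y = (p : ℝ) ^ (k' - k) * y' := by
      rw [zpow_sub₀ hp0.ne', div_mul_eq_mul_div, eq_div_iff hpk.ne']
      linarith [h]
    have : (p : ℝ) * c ≤ (p : ℝ) ^ (k' - k) * y' :=
      mul_le_mul hge hz hc.le (le_trans hp0.le hge)
    linarith
  rcases lt_trichotomy k k' with hlt | heq | hgt
  · exact absurd hlt (key hy hy' hz h)
  · subst heq
    exact ⟨rfl, mul_left_cancel₀ (zpow_pos hp0 k).ne' h⟩
  · exact absurd hgt (key hz hz' hy h.symm)

/-- The exponent `k(x) = ⌊log_p (x/c)⌋` of the reduction to `[c, pc)`. [folklore] -/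
def fundExp (p : ℕ) (c x : ℝ) : ℤ := Int.log p (x / c)

/-- **The representative of `x` in the fundamental domain `[c, pc)`**: `x / p^{k(x)}`. [folklore] -/
def fundRed (p : ℕ) (c x : ℝ) : ℝ := x / (p : ℝ) ^ fundExp p c x

/-- The representative lies in `[c, pc)` and `x = p^k · fundRed`. [folklore] -/
theorem fundRed_spec {p : ℕ} (hp : 1 < p) {c : ℝ} (hc : 0 < c) {x : ℝ} (hx : 0 < x) :
    c ≤ fundRed p c x ∧ fundRed p c x < p * c ∧ x = (p : ℝ) ^ fundExp p c x * fundRed p c x := by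
  have hp0 : (0 : ℝ) < p := by exact_mod_cast (zero_lt_one.trans hp)
  have h1 : (p : ℝ) ^ fundExp p c x ≤ x / c := Int.zpow_log_le_self hp (div_pos hx hc)
  have h2 : x / c < (p : ℝ) ^ (fundExp p c x + 1) := Int.lt_zpow_succ_log_self hp (x / c)
  have hpk : (0 : ℝ) < (p : ℝ) ^ fundExp p c x := zpow_pos hp0 _
  refine ⟨?_, ?_, ?_⟩
  · rw [fundRed, le_div_iff₀ hpk]
    rw [le_div_iff₀ hc] at h1
    linarith
  · rw [fundRed, div_lt_iff₀ hpk]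
    rw [div_lt_iff₀ hc, zpow_add_one₀ hp0.ne'] at h2
    linarith
  · rw [fundRed, mul_div_cancel₀ _ hpk.ne']

/-- The representative of `p^k y`, `y ∈ [c, pc)`, is `y`. [folklore] -/
theorem fundRed_zpow_mul_of_mem {p : ℕ} (hp : 1 < p) {c : ℝ} (hc : 0 < c) {y : ℝ} (hy : c ≤ y)
    (hy' : y < p * c) (k : ℤ) : fundRed p c ((p : ℝ) ^ k * y) = y := by
  have hp0 : (0 : ℝ) < p := by exact_mod_cast (zero_lt_one.trans hp)
  have hx : 0 < (p : ℝ) ^ k * y := mul_pos (zpow_pos hp0 k) (hc.trans_le hy)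
  obtain ⟨h1, h2, h3⟩ := fundRed_spec hp hc hx
  exact ((zpow_mul_eq_zpow_mul_iff hp hc h1 h2 hy hy' h3.symm).2)

/-- The representative of an element of `[c, pc)` is itself. [folklore] -/
theorem fundRed_of_mem {p : ℕ} (hp : 1 < p) {c : ℝ} (hc : 0 < c) {y : ℝ} (hy : c ≤ y)
    (hy' : y < p * c) : fundRed p c y = y := by
  simpa using fundRed_zpow_mul_of_mem hp hc hy hy' 0

/-- The representative is a class function: `fundRed(p^k x) = fundRed(x)`. [folklore] -/
theorem fundRed_zpow_mul {p : ℕ} (hp : 1 < p) {c : ℝ} (hc : 0 < c) {x : ℝ} (hx : 0 < x) (k : ℤ) :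
    fundRed p c ((p : ℝ) ^ k * x) = fundRed p c x := by
  have hp0 : (0 : ℝ) < p := by exact_mod_cast (zero_lt_one.trans hp)
  obtain ⟨h1, h2, h3⟩ := fundRed_spec hp hc hx
  conv_lhs => rw [h3, ← mul_assoc, ← zpow_add₀ hp0.ne']
  exact fundRed_zpow_mul_of_mem hp hc h1 h2 _

/-- `fundRed(px) = fundRed(x)`. [folklore] -/
theorem fundRed_mul_p {p : ℕ} (hp : 1 < p) {c : ℝ} (hc : 0 < c) {x : ℝ} (hx : 0 < x) :
    fundRed p c (p * x) = fundRed p c x := by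
  simpa using fundRed_zpow_mul hp hc hx 1

/-- `χ(p^k x) = χ(x)` for every real `x` and `k ∈ ℤ`. [folklore] -/
theorem pFractionChi_zpow_mul {p : ℕ} (hp : 0 < p) (x : ℝ) (k : ℤ) :
    pFractionChi p ((p : ℝ) ^ k * x) = pFractionChi p x := by
  have hp0 : (p : ℝ) ≠ 0 := by exact_mod_cast hp.ne'
  have hnat : ∀ (m : ℕ) (u : ℝ), pFractionChi p ((p : ℝ) ^ m * u) = pFractionChi p u := by
    intro m
    induction m with
    | zero => intro u; simp
    | succ m ih =>
      intro u
      rw [pow_succ, mul_comm ((p : ℝ) ^ m), mul_assoc, pFractionChi_mul_p hp, ih u]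
  obtain ⟨m, rfl | rfl⟩ := k.eq_nat_or_neg
  · rw [zpow_natCast]; exact hnat m x
  · rw [zpow_neg, zpow_natCast]
    have h := hnat m (((p : ℝ) ^ m)⁻¹ * x)
    rw [← mul_assoc, mul_inv_cancel₀ (by positivity), one_mul] at h
    exact h.symm

/-- A class function on `(0, ∞)` (`D(px) = D(x)`) summed over `[1, p)` only sees the
representative: value of a divisor along a class. [folklore] -/
theorem CpDivisor.apply_zpow_mul {p : ℕ} (hp : 0 < p) (D : CpDivisor p) {x : ℝ} (hx : 0 < x)
    (k : ℤ) : D.toFun ((p : ℝ) ^ k * x) = D.toFun x :=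
  periodic_zpow hp D.periodic k x hx

/-! ### Point divisors and sums of divisors -/

/-- Membership in the class `μ p^ℤ` of `μ`. [folklore] -/
def InClass (p : ℕ) (μ x : ℝ) : Prop := ∃ k : ℤ, x = (p : ℝ) ^ k * μ

/-- `px ∈ μp^ℤ ⇔ x ∈ μp^ℤ`. [folklore] -/
theorem inClass_mul_p_iff {p : ℕ} (hp : 0 < p) {μ x : ℝ} : InClass p μ (p * x) ↔ InClass p μ x := by
  have hp0 : (p : ℝ) ≠ 0 := by exact_mod_cast hp.ne'
  constructor
  · rintro ⟨k, hk⟩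
    refine ⟨k - 1, ?_⟩
    rw [zpow_sub_one₀ hp0, mul_right_comm, ← hk]
    field_simp
  · rintro ⟨k, rfl⟩
    exact ⟨k + 1, by rw [zpow_add_one₀ hp0]; ring⟩

open Classical in
/-- **The point divisor `P = (μH_p, v)`**: value `v` on the class of `μ > 0`, zero elsewhere
(`v/μ ∈ H_p`; Lemma 5.13 (ii): "`P_λ` the positive divisor which vanishes for `H' ≠ H` and takes the
value `λ` at `H`"). [cite: ConnesConsani2017ScalingSite, Lemma 5.13 (ii) (proof)] -/
def CpDivisor.single (p : ℕ) (hp : 1 < p) (μ v : ℝ) (hμ : 0 < μ) (hv : IsPFraction p (v / μ)) :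
    CpDivisor p where
  toFun x := if InClass p μ x then v else 0
  periodic _ _ := by rw [inClass_mul_p_iff (zero_lt_one.trans hp)]
  mem x hx := by
    by_cases h : InClass p μ x
    · rw [if_pos h]
      obtain ⟨k, rfl⟩ := h
      have hp0 : (p : ℝ) ≠ 0 := by exact_mod_cast (zero_lt_one.trans hp).ne'
      have : v / ((p : ℝ) ^ k * μ) = (p : ℝ) ^ (-k) * (v / μ) := by
        rw [zpow_neg]; field_simp
      rw [this]
      exact hv.mul_zpow (-k)
    · rw [if_neg h, zero_div]; exact isPFraction_zero p
  finite_support := by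
    apply (Set.finite_singleton (fundRed p 1 μ)).subset
    intro x ⟨hx1, hx2, hx3⟩
    have h : InClass p μ x := by
      by_contra h; exact hx3 (if_neg h)
    obtain ⟨k, rfl⟩ := h
    rw [Set.mem_singleton_iff]
    have := fundRed_of_mem hp zero_lt_one (y := (p : ℝ) ^ k * μ) hx1 (by simpa using hx2)
    rw [fundRed_zpow_mul hp zero_lt_one hμ] at this
    exact this.symm

/-- Values of the point divisor. [folklore] -/
theorem CpDivisor.single_apply {p : ℕ} (hp : 1 < p) {μ v : ℝ} (hμ : 0 < μ)
    (hv : IsPFraction p (v / μ)) (x : ℝ) :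
    (CpDivisor.single p hp μ v hμ hv).toFun x =
      @ite _ (InClass p μ x) (Classical.propDecidable _) v 0 := rfl

/-- The sum of two divisors. [cite: ConnesConsani2017ScalingSite, Prop. 5.4 (i)] -/
def CpDivisor.add {p : ℕ} (hp : p ≠ 0) (D E : CpDivisor p) : CpDivisor p where
  toFun x := D.toFun x + E.toFun x
  periodic x hx := by rw [D.periodic x hx, E.periodic x hx]
  mem x hx := by rw [add_div]; exact (D.mem x hx).add hp (E.mem x hx)
  finite_support := by
    apply (D.finite_support.union E.finite_support).subset
    intro x ⟨hx1, hx2, hx3⟩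
    by_contra hcon
    simp only [Set.mem_union, Set.mem_setOf_eq, not_or, not_and, not_not] at hcon
    exact hx3 (by rw [hcon.1 hx1 hx2, hcon.2 hx1 hx2, add_zero])

/-- Finite support of a divisor on `[1, p)` in `Function.support` form. [folklore] -/
theorem CpDivisor.finite_inter_support {p : ℕ} (D : CpDivisor p) :
    (Ico 1 (p : ℝ) ∩ Function.support D.toFun).Finite :=
  D.finite_support.subset fun _ hx ↦ ⟨hx.1.1, hx.1.2, hx.2⟩

/-- Finite support of `χ(D(x)/x)` on `[1, p)`. [folklore] -/
theorem CpDivisor.finite_inter_support_chi {p : ℕ} (hp : 0 < p) (D : CpDivisor p) :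
    (Ico 1 (p : ℝ) ∩ Function.support fun x ↦ pFractionChi p (D.toFun x / x)).Finite := by
  refine D.finite_inter_support.subset fun x hx ↦ ⟨hx.1, ?_⟩
  intro h0
  apply hx.2
  simp only [h0, zero_div, pFractionChi_zero hp]

/-- `deg` is additive. [cite: ConnesConsani2017ScalingSite, Prop. 5.4 (iii)] -/
theorem cpDeg_add {p : ℕ} (hp : p ≠ 0) (D E : CpDivisor p) :
    cpDeg (D.add hp E) = cpDeg D + cpDeg E := by
  unfold cpDeg
  rw [setOf_fundamentalDomain_eq]
  exact finsum_mem_add_distrib' D.finite_inter_support E.finite_inter_support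

/-- `χ` is additive on divisors. [cite: ConnesConsani2017ScalingSite, Prop. 5.5] -/
theorem cpChi_add {p : ℕ} (hp : 0 < p) (D E : CpDivisor p) :
    cpChi (D.add hp.ne' E) = cpChi D + cpChi E := by
  unfold cpChi
  rw [setOf_fundamentalDomain_eq, ← finsum_mem_add_distrib' (D.finite_inter_support_chi hp)
    (E.finite_inter_support_chi hp)]
  refine finsum_mem_congr rfl fun x hx ↦ ?_
  show pFractionChi p ((D.toFun x + E.toFun x) / x) = _
  rw [add_div, pFractionChi_add hp (D.mem x (zero_lt_one.trans_le hx.1))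
    (E.mem x (zero_lt_one.trans_le hx.1))]

/-- `Σᶠ_{x ∈ s} (-f x) = -Σᶠ_{x ∈ s} f x` without finiteness assumptions. [folklore] -/
theorem finsum_mem_neg_distrib_of_any {α G : Type*} [AddCommGroup G] (f : α → G) (s : Set α) :
    ∑ᶠ x ∈ s, -f x = -∑ᶠ x ∈ s, f x := by
  simp only [finsum_mem_def, finsum_neg_distrib]

/-- `deg(-D) = -deg(D)`. [folklore] -/
theorem cpDeg_neg {p : ℕ} (D : CpDivisor p) : cpDeg D.neg = -cpDeg D := by
  unfold cpDeg
  show ∑ᶠ x ∈ _, -D.toFun x = _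
  rw [finsum_mem_neg_distrib_of_any]

/-- `χ(-D) = -χ(D)`. [folklore] -/
theorem cpChi_neg {p : ℕ} (hp : 0 < p) (D : CpDivisor p) : cpChi D.neg = -cpChi D := by
  unfold cpChi
  show ∑ᶠ x ∈ _, pFractionChi p (-D.toFun x / x) = _
  rw [← finsum_mem_neg_distrib_of_any]
  refine finsum_mem_congr rfl fun x _ ↦ ?_
  rw [neg_div, pFractionChi_neg hp]

/-- The degree of a point divisor is its value: `deg P = v`. [cite: ConnesConsani2017ScalingSite, Lemma 5.13 (ii) (proof: "deg(P_λ) = λ")] -/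
theorem cpDeg_single {p : ℕ} (hp : 1 < p) {μ v : ℝ} (hμ : 0 < μ) (hv : IsPFraction p (v / μ)) :
    cpDeg (CpDivisor.single p hp μ v hμ hv) = v := by
  classical
  obtain ⟨h1, h2, h3⟩ := fundRed_spec hp zero_lt_one hμ
  rw [mul_one] at h2
  have hrep : InClass p μ (fundRed p 1 μ) :=
    ⟨-fundExp p 1 μ, by rw [fundRed, zpow_neg, div_eq_inv_mul]⟩
  unfold cpDeg
  rw [setOf_fundamentalDomain_eq, finsum_mem_eq_sum_of_subset (t := {fundRed p 1 μ}) _ ?_ ?_,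
    Finset.sum_singleton, CpDivisor.single_apply, if_pos hrep]
  · intro x ⟨⟨hx1, hx2⟩, hx3⟩
    rw [Function.mem_support, CpDivisor.single_apply] at hx3
    have h : InClass p μ x := by by_contra h; exact hx3 (if_neg h)
    obtain ⟨k, rfl⟩ := h
    simp only [Finset.coe_singleton, Set.mem_singleton_iff]
    rw [← fundRed_of_mem hp zero_lt_one hx1 (by simpa using hx2), fundRed_zpow_mul hp zero_lt_one hμ]
  · intro x hx
    simp only [Finset.coe_singleton, Set.mem_singleton_iff] at hx
    rw [hx]
    exact ⟨h1, h2⟩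

/-- The invariant of a point divisor: `χ(P) = χ(v/μ)`. [cite: ConnesConsani2017ScalingSite, Lemma 5.13 (ii) (proof: "χ(P_λ) = 1")] -/
theorem cpChi_single {p : ℕ} (hp : 1 < p) {μ v : ℝ} (hμ : 0 < μ) (hv : IsPFraction p (v / μ)) :
    cpChi (CpDivisor.single p hp μ v hμ hv) = pFractionChi p (v / μ) := by
  classical
  have hp' : 0 < p := zero_lt_one.trans hp
  have hp0 : (p : ℝ) ≠ 0 := by exact_mod_cast hp'.ne'
  obtain ⟨h1, h2, h3⟩ := fundRed_spec hp zero_lt_one hμ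
  rw [mul_one] at h2
  have hrep : InClass p μ (fundRed p 1 μ) :=
    ⟨-fundExp p 1 μ, by rw [fundRed, zpow_neg, div_eq_inv_mul]⟩
  unfold cpChi
  rw [setOf_fundamentalDomain_eq, finsum_mem_eq_sum_of_subset (t := {fundRed p 1 μ}) _ ?_ ?_,
    Finset.sum_singleton, CpDivisor.single_apply, if_pos hrep]
  · -- `v / fundRed = p^k (v/μ)`
    have e : v / fundRed p 1 μ = (p : ℝ) ^ fundExp p 1 μ * (v / μ) := by
      rw [fundRed, div_div_eq_mul_div]; ring
    rw [e, pFractionChi_zpow_mul hp']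
  · intro x ⟨⟨hx1, hx2⟩, hx3⟩
    rw [Function.mem_support, CpDivisor.single_apply] at hx3
    have h : InClass p μ x := by
      by_contra h; apply hx3; rw [if_neg h, zero_div, pFractionChi_zero hp']
    obtain ⟨k, rfl⟩ := h
    simp only [Finset.coe_singleton, Set.mem_singleton_iff]
    rw [← fundRed_of_mem hp zero_lt_one hx1 (by simpa using hx2), fundRed_zpow_mul hp zero_lt_one hμ]
  · intro x hx
    simp only [Finset.coe_singleton, Set.mem_singleton_iff] at hx
    rw [hx]
    exact ⟨h1, h2⟩


/-! ### The rational function with prescribed breakpoints and slopes -/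

/-- Monotonicity of a sequence from its successive inequalities. [folklore] -/
theorem seq_lt_of_lt {lam : ℕ → ℝ} {n : ℕ} (hlam : ∀ i, i ≤ n → lam i < lam (i + 1)) {i j : ℕ}
    (hij : i < j) (hj : j ≤ n + 1) : lam i < lam j := by
  induction j with
  | zero => exact absurd hij (Nat.not_lt_zero _)
  | succ j ih =>
    rcases Nat.lt_succ_iff_lt_or_eq.1 hij with h | h
    · exact (ih h (by omega)).trans (hlam j (by omega))
    · rw [h]; exact hlam j (by omega)

/-- Monotonicity of a sequence (weak). [folklore] -/
theorem seq_le_of_le {lam : ℕ → ℝ} {n : ℕ} (hlam : ∀ i, i ≤ n → lam i < lam (i + 1)) {i j : ℕ}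
    (hij : i ≤ j) (hj : j ≤ n + 1) : lam i ≤ lam j := by
  rcases hij.eq_or_lt with h | h
  · rw [h]
  · exact (seq_lt_of_lt hlam h hj).le

/-- The index of the piece containing `x`: the largest `j ≤ n` with `λ_j ≤ x`. [folklore] -/
def pieceIndex (lam : ℕ → ℝ) (n : ℕ) (x : ℝ) : ℕ := Nat.findGreatest (fun i ↦ lam i ≤ x) n

/-- The cumulative values `c_j = Σ_{i<j} h_i (λ_{i+1} - λ_i)` (so that `c_0 = 0`, normalisation
`f(λ_0) = 0`). [cite: ConnesConsani2017ScalingSite, Thm. 5.6 (proof)] -/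
def pieceVal (lam h : ℕ → ℝ) (j : ℕ) : ℝ := ∑ i ∈ Finset.range j, h i * (lam (i + 1) - lam i)

/-- The piecewise-affine function on one period: "affine with slope `h_j` in the interval `I_j`
and normalized by `f(λ_0) = 0`". [cite: ConnesConsani2017ScalingSite, Thm. 5.6 (proof)] -/
def affineExt (lam h : ℕ → ℝ) (n : ℕ) (x : ℝ) : ℝ :=
  pieceVal lam h (pieceIndex lam n x) + h (pieceIndex lam n x) * (x - lam (pieceIndex lam n x))

/-- "extend `f` by periodicity so that `f(pλ) = f(λ)`". [cite: ConnesConsani2017ScalingSite, Thm. 5.6 (proof)] -/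
def periodicExt (p : ℕ) (lam h : ℕ → ℝ) (n : ℕ) (x : ℝ) : ℝ :=
  affineExt lam h n (fundRed p (lam 0) x)

/-- The piece index of a point of `[λ_j, λ_{j+1})`. [folklore] -/
theorem pieceIndex_eq {lam : ℕ → ℝ} {n : ℕ} (hlam : ∀ i, i ≤ n → lam i < lam (i + 1)) {j : ℕ}
    (hj : j ≤ n) {x : ℝ} (hx1 : lam j ≤ x) (hx2 : x < lam (j + 1)) : pieceIndex lam n x = j := by
  unfold pieceIndex
  rw [Nat.findGreatest_eq_iff]
  refine ⟨hj, fun _ ↦ hx1, fun m hjm hmn hm ↦ ?_⟩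
  have : lam (j + 1) ≤ lam m := seq_le_of_le hlam (by omega) (by omega)
  linarith

/-- The piece index of the right end `λ_{n+1}` is `n`. [folklore] -/
theorem pieceIndex_last {lam : ℕ → ℝ} {n : ℕ} (hlam : ∀ i, i ≤ n → lam i < lam (i + 1)) :
    pieceIndex lam n (lam (n + 1)) = n := by
  unfold pieceIndex
  rw [Nat.findGreatest_eq_iff]
  exact ⟨le_rfl, fun _ ↦ (hlam n le_rfl).le, fun m h1 h2 ↦ absurd h2 (by omega)⟩

/-- `affineExt` is affine of slope `h_j` on `[λ_j, λ_{j+1}]`, with value `c_j` at `λ_j`. [folklore] -/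
theorem affineExt_eq {lam h : ℕ → ℝ} {n : ℕ} (hlam : ∀ i, i ≤ n → lam i < lam (i + 1)) {j : ℕ}
    (hj : j ≤ n) {x : ℝ} (hx1 : lam j ≤ x) (hx2 : x ≤ lam (j + 1)) :
    affineExt lam h n x = pieceVal lam h j + h j * (x - lam j) := by
  rcases hx2.lt_or_eq with hlt | heq
  · unfold affineExt
    rw [pieceIndex_eq hlam hj hx1 hlt]
  · rcases Nat.lt_or_ge j n with hjn | hjn
    · -- `x = λ_{j+1}` is the left end of the next piece
      unfold affineExt
      rw [pieceIndex_eq hlam (show j + 1 ≤ n by omega) heq.ge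
        (by rw [heq]; exact hlam (j + 1) (by omega)), heq, sub_self, mul_zero, add_zero,
        pieceVal, Finset.sum_range_succ]
      rfl
    · -- `j = n`, `x = λ_{n+1}`
      have hj' : j = n := le_antisymm hj hjn
      subst hj'
      unfold affineExt
      rw [heq, pieceIndex_last hlam]

/-- `affineExt(λ_j) = c_j`. [folklore] -/
theorem affineExt_lam {lam h : ℕ → ℝ} {n : ℕ} (hlam : ∀ i, i ≤ n → lam i < lam (i + 1)) {j : ℕ}
    (hj : j ≤ n) : affineExt lam h n (lam j) = pieceVal lam h j := by
  rw [affineExt_eq hlam hj le_rfl (hlam j hj).le, sub_self, mul_zero, add_zero]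

/-- The periodic extension is periodic. [folklore] -/
theorem periodicExt_mul_p {p : ℕ} (hp : 1 < p) {lam h : ℕ → ℝ} {n : ℕ} (h0 : 0 < lam 0) {x : ℝ}
    (hx : 0 < x) : periodicExt p lam h n (p * x) = periodicExt p lam h n x := by
  unfold periodicExt
  rw [fundRed_mul_p hp h0 hx]

/-- The periodic extension agrees with `affineExt` on the period `[λ_0, pλ_0)`. [folklore] -/
theorem periodicExt_of_mem {p : ℕ} (hp : 1 < p) {lam h : ℕ → ℝ} {n : ℕ} (h0 : 0 < lam 0) {x : ℝ}
    (hx1 : lam 0 ≤ x) (hx2 : x < p * lam 0) : periodicExt p lam h n x = affineExt lam h n x := by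
  unfold periodicExt
  rw [fundRed_of_mem hp h0 hx1 hx2]

/-- **The constructed function has the prescribed piece data** (closure condition
`Σ_j h_j (λ_{j+1} - λ_j) = 0`, i.e. `f(pλ_0) = f(λ_0)`). [cite: ConnesConsani2017ScalingSite, Thm. 5.6 (proof)] -/
def cpPiecesOfData (p : ℕ) (hp : 1 < p) (lam h : ℕ → ℝ) (n : ℕ) (h0 : 0 < lam 0)
    (hlam : ∀ i, i ≤ n → lam i < lam (i + 1)) (hlast : lam (n + 1) = p * lam 0)
    (hmem : ∀ j, j ≤ n → IsPFraction p (h j)) (hclos : pieceVal lam h (n + 1) = 0) :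
    CpPieces p (periodicExt p lam h n) where
  n := n
  lam := lam
  h := h
  lam_pos := h0
  lam_lt := hlam
  lam_last := hlast
  h_mem := hmem
  piece j hj x hx1 hx2 := by
    have hj0 : lam 0 ≤ lam j := seq_le_of_le hlam (Nat.zero_le j) (by omega)
    have hjlt : lam j < p * lam 0 := by rw [← hlast]; exact seq_lt_of_lt hlam (by omega) le_rfl
    rw [periodicExt_of_mem hp h0 hj0 hjlt, affineExt_lam hlam hj]
    rcases lt_or_eq_of_le (hx2.trans (by rw [← hlast]; exact seq_le_of_le hlam (by omega) le_rfl) :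
      x ≤ p * lam 0) with hlt | heq
    · rw [periodicExt_of_mem hp h0 (hj0.trans hx1) hlt, affineExt_eq hlam hj hx1 hx2]
    · -- `x = pλ_0 = λ_{n+1}`, forcing `j = n`; use the closure condition
      have hjn : j = n := by
        by_contra hne
        have : lam (j + 1) < lam (n + 1) := seq_lt_of_lt hlam (by omega) le_rfl
        rw [hlast, ← heq] at this
        linarith
      subst hjn
      rw [heq, periodicExt_mul_p hp h0 h0, periodicExt_of_mem hp h0 le_rfl
        (by nlinarith [show (1 : ℝ) < p by exact_mod_cast hp]), affineExt_lam hlam (Nat.zero_le _)]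
      rw [← hlast]
      have : pieceVal lam h (j + 1) = pieceVal lam h j + h j * (lam (j + 1) - lam j) := by
        rw [pieceVal, Finset.sum_range_succ]; rfl
      rw [pieceVal, Finset.range_zero, Finset.sum_empty]
      linarith [hclos]

/-- Piece data yield the `Fin`-indexed definition `IsCpRational`. [folklore] -/
theorem CpPieces.isCpRational {p : ℕ} {f : ℝ → ℝ} (P : CpPieces p f)
    (hper : ∀ x : ℝ, 0 < x → f (p * x) = f x) : IsCpRational p f := by
  refine ⟨hper, P.n, fun i ↦ P.lam i, fun j ↦ P.h j, P.lam_pos, ?_, P.lam_last, fun j ↦ P.h_mem j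
    (by omega), fun j x hx1 hx2 ↦ ?_⟩
  · refine Fin.strictMono_iff_lt_succ.2 fun i ↦ ?_
    simpa using P.lam_lt i (by omega)
  · simpa using P.piece j (by omega) x (by simpa using hx1) (by simpa using hx2)


/-! ### Theorem 5.6, the inclusion `Ker(deg, χ) ⊆ 𝒫` -/

/-- Finset sums of elements of `H_p` lie in `H_p`. [folklore] -/
theorem IsPFraction.sum {p : ℕ} (hp : p ≠ 0) {ι : Type*} (s : Finset ι) (g : ι → ℝ)
    (hg : ∀ i ∈ s, IsPFraction p (g i)) : IsPFraction p (∑ i ∈ s, g i) := by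
  classical
  induction s using Finset.induction_on with
  | empty => simpa using isPFraction_zero p
  | insert a s ha ih =>
    rw [Finset.sum_insert ha]
    exact (hg a (by simp)).add hp (ih fun i hi ↦ hg i (by simp [hi]))

/-- `χ` of a Finset sum of elements of `H_p`. [folklore] -/
theorem pFractionChi_sum {p : ℕ} (hp : 0 < p) {ι : Type*} (s : Finset ι) (g : ι → ℝ)
    (hg : ∀ i ∈ s, IsPFraction p (g i)) :
    pFractionChi p (∑ i ∈ s, g i) = ∑ i ∈ s, pFractionChi p (g i) := by
  classical
  induction s using Finset.induction_on with
  | empty => simp [pFractionChi_zero hp]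
  | insert a s ha ih =>
    rw [Finset.sum_insert ha, Finset.sum_insert ha,
      pFractionChi_add hp (hg a (by simp)) (IsPFraction.sum hp.ne' s g fun i hi ↦ hg i (by simp [hi])),
      ih fun i hi ↦ hg i (by simp [hi])]

/-- "`σ/(1-p)` takes values in `H_p` if and only if `σ` is divisible by `p - 1` in `H_p` iff
`χ(D) = 0`": the direction used. [cite: ConnesConsani2017ScalingSite, Thm. 5.6 (proof)] -/
theorem IsPFraction.div_pred_of_chi_eq_zero {p : ℕ} (hp : 1 < p) {σ : ℝ} (hσ : IsPFraction p σ)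
    (hχ : pFractionChi p σ = 0) : IsPFraction p (σ / ((p : ℝ) - 1)) := by
  obtain ⟨a, N, rfl⟩ := hσ
  rw [pFractionChi_eq (zero_lt_one.trans hp) rfl, ZMod.intCast_zmod_eq_zero_iff_dvd] at hχ
  obtain ⟨b, hb⟩ := hχ
  refine ⟨b, N, ?_⟩
  have hp1 : (p : ℝ) - 1 ≠ 0 := by
    have : (1 : ℝ) < p := by exact_mod_cast hp
    linarith
  have hab : (a : ℝ) = ((p : ℝ) - 1) * b := by
    rw [hb]; push_cast [Nat.cast_sub hp.le]; ring
  rw [hab]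
  field_simp

/-- A divisor is determined on `(0, ∞)` by its values on `[1, p)`. [folklore] -/
theorem CpDivisor.apply_eq_apply_fundRed {p : ℕ} (hp : 1 < p) (D : CpDivisor p) {x : ℝ}
    (hx : 0 < x) : D.toFun x = D.toFun (fundRed p 1 x) := by
  obtain ⟨h1, -, h3⟩ := fundRed_spec hp zero_lt_one hx
  conv_lhs => rw [h3]
  exact D.apply_zpow_mul (zero_lt_one.trans hp) (zero_lt_one.trans_le h1) _

/-- **Theorem 5.6, `Ker(deg, χ) ⊆ 𝒫`**: "any divisor `D` such that `deg(D) = 0` and `χ(D) = 0` is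
principal" — slopes `h_n = σ/(1-p)`, `h_j - h_{j-1} = a_j`, `f` affine of slope `h_j` on `I_j`,
`f(pλ_0) = f(λ_0)` because `Σ a_j λ_j = deg D = 0`, extended by periodicity.
[cite: ConnesConsani2017ScalingSite, Thm. 5.6 (proof)] -/
theorem CpDivisor.isPrincipal_of_cpDeg_eq_zero_of_cpChi_eq_zero {p : ℕ} (hp : p.Prime)
    (D : CpDivisor p) (hdeg : cpDeg D = 0) (hchi : cpChi D = 0) : D.IsPrincipal := by
  classical
  have hp1 : 1 < p := hp.one_lt
  have hp0 : 0 < p := hp.pos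
  have hpR : (1 : ℝ) < p := by exact_mod_cast hp1
  set S : Finset ℝ := D.finite_support.toFinset with hS
  have hSmem : ∀ x, x ∈ S ↔ 1 ≤ x ∧ x < p ∧ D.toFun x ≠ 0 := fun x ↦ by
    rw [hS, Set.Finite.mem_toFinset]; rfl
  have hDzero : ∀ x, 0 < x → fundRed p 1 x ∉ S → D.toFun x = 0 := by
    intro x hx hnot
    rw [D.apply_eq_apply_fundRed hp1 hx]
    by_contra h
    obtain ⟨h1, h2, -⟩ := fundRed_spec hp1 zero_lt_one hx
    exact hnot ((hSmem _).2 ⟨h1, by simpa using h2, h⟩)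
  by_cases hSe : S = ∅
  · refine ⟨fun _ ↦ 0, isCpRational_const hp1 0, fun x hx ↦ ?_⟩
    rw [cpOrder_const, hDzero x hx (by simp [hSe])]
  -- enumerate the support in `[1, p)` increasingly
  set m : ℕ := S.card with hm
  have hmpos : 0 < m := Finset.card_pos.2 (Finset.nonempty_iff_ne_empty.2 hSe)
  set e : Fin m ↪o ℝ := S.orderEmbOfFin rfl with he
  have he_mem : ∀ i, e i ∈ S := fun i ↦ S.orderEmbOfFin_mem rfl i
  have he_surj : ∀ x ∈ S, ∃ i, e i = x := by
    intro x hx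
    have : x ∈ Set.range e := by rw [he, Finset.range_orderEmbOfFin]; exact hx
    exact this
  have he_bounds : ∀ i, 1 ≤ e i ∧ e i < p := fun i ↦
    ⟨((hSmem _).1 (he_mem i)).1, ((hSmem _).1 (he_mem i)).2.1⟩
  set n : ℕ := m - 1 with hn
  have hnm : n + 1 = m := by omega
  set lam : ℕ → ℝ := fun i ↦ if hi : i < m then e ⟨i, hi⟩ else p * e ⟨0, hmpos⟩ with hlam
  have hlam_of_lt : ∀ i (hi : i < m), lam i = e ⟨i, hi⟩ := fun i hi ↦ by simp [hlam, hi]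
  have hlam_m : lam m = p * e ⟨0, hmpos⟩ := by simp [hlam]
  have hlam0 : lam 0 = e ⟨0, hmpos⟩ := hlam_of_lt 0 hmpos
  have h0pos : 0 < lam 0 := by rw [hlam0]; linarith [(he_bounds ⟨0, hmpos⟩).1]
  have hlam_lt : ∀ i, i ≤ n → lam i < lam (i + 1) := by
    intro i hi
    rw [hlam_of_lt i (by omega)]
    by_cases hi1 : i + 1 < m
    · rw [hlam_of_lt (i + 1) hi1]; exact e.strictMono (Fin.mk_lt_mk.2 (by omega))
    · have him : i + 1 = m := by omega
      rw [him, hlam_m]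
      nlinarith [(he_bounds ⟨i, by omega⟩).2, (he_bounds ⟨0, hmpos⟩).1]
  have hlast : lam (n + 1) = p * lam 0 := by rw [hnm, hlam_m, hlam0]
  have hlam_pos : ∀ i, i ≤ n + 1 → 0 < lam i := fun i hi ↦
    h0pos.trans_le (seq_le_of_le hlam_lt (Nat.zero_le i) hi)
  -- sums over the support
  have hsumS : ∀ {M : Type} [AddCommMonoid M] (g : ℝ → M),
      ∑ x ∈ S, g x = ∑ i ∈ Finset.range m, g (lam i) := by
    intro M _ g
    calc ∑ x ∈ S, g x = ∑ x ∈ (Finset.univ : Finset (Fin m)).image e, g x := by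
          rw [Finset.image_orderEmbOfFin_univ]
      _ = ∑ i : Fin m, g (e i) := Finset.sum_image fun i _ j _ h ↦ e.injective h
      _ = ∑ i : Fin m, g (lam i) := Finset.sum_congr rfl fun i _ ↦ by rw [hlam_of_lt i i.2]
      _ = ∑ i ∈ Finset.range m, g (lam i) := Fin.sum_univ_eq_sum_range (fun i ↦ g (lam i)) m
  -- the values `a_j = D(λ_j)/λ_j ∈ H_p` and `σ = Σ a_j`
  set a : ℕ → ℝ := fun i ↦ D.toFun (lam i) / lam i with ha
  have ha_mem : ∀ i, i ≤ n → IsPFraction p (a i) := fun i hi ↦ D.mem _ (hlam_pos i (by omega))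
  set σ : ℝ := ∑ i ∈ Finset.range m, a i with hσ
  have hσ_mem : IsPFraction p σ :=
    IsPFraction.sum hp0.ne' _ _ fun i hi ↦ ha_mem i (by simp at hi; omega)
  have hdegS : cpDeg D = ∑ i ∈ Finset.range m, D.toFun (lam i) := by
    unfold cpDeg
    rw [setOf_fundamentalDomain_eq, finsum_mem_eq_sum_of_subset (t := S) _ ?_ ?_, hsumS]
    · rintro x ⟨⟨hx1, hx2⟩, hx3⟩; exact (hSmem x).2 ⟨hx1, hx2, hx3⟩
    · intro x hx; obtain ⟨h1, h2, -⟩ := (hSmem x).1 hx; exact ⟨h1, h2⟩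
  have hchiS : cpChi D = pFractionChi p σ := by
    unfold cpChi
    rw [setOf_fundamentalDomain_eq, finsum_mem_eq_sum_of_subset (t := S) _ ?_ ?_, hsumS, hσ,
      pFractionChi_sum hp0 _ _ fun i hi ↦ ha_mem i (by simp at hi; omega)]
    · rintro x ⟨⟨hx1, hx2⟩, hx3⟩
      refine (hSmem x).2 ⟨hx1, hx2, fun h0 ↦ hx3 ?_⟩
      simp only [Function.mem_support, h0, zero_div, pFractionChi_zero hp0, ne_eq, not_true] at *
    · intro x hx; obtain ⟨h1, h2, -⟩ := (hSmem x).1 hx; exact ⟨h1, h2⟩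
  have hσchi : pFractionChi p σ = 0 := by rw [← hchiS, hchi]
  -- the slopes `h_j = pσ/(1-p) + Σ_{i ≤ j} a_i`
  set h : ℕ → ℝ := fun j ↦ (p : ℝ) * (σ / (1 - p)) + ∑ i ∈ Finset.range (j + 1), a i with hh
  have h1p : (1 : ℝ) - p ≠ 0 := by linarith
  have hh_mem : ∀ j, j ≤ n → IsPFraction p (h j) := by
    intro j hj
    refine IsPFraction.add hp0.ne' ?_
      (IsPFraction.sum hp0.ne' _ _ fun i hi ↦ ha_mem i (by simp at hi; omega))
    have hq := (hσ_mem.div_pred_of_chi_eq_zero hp1 hσchi).neg.mul_p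
    convert hq using 1
    congr 1
    rw [← div_neg, neg_sub]
  have hh_succ : ∀ j, h (j + 1) - h j = a (j + 1) := fun j ↦ by
    simp only [hh]
    rw [Finset.sum_range_succ (n := j + 1)]
    ring
  have hh_zero : h 0 - p * h n = a 0 := by
    simp only [hh]
    rw [Finset.sum_range_one, hnm, ← hσ]
    field_simp
    ring
  -- closure `Σ_j h_j (λ_{j+1} - λ_j) = 0 ⇔ deg D = 0`
  have hclos : pieceVal lam h (n + 1) = 0 := by
    have hab := abel_identity lam h n
    simp_rw [hh_succ] at hab
    have h1 : lam 0 * h 0 - lam (n + 1) * h n = lam 0 * a 0 := by rw [hlast, ← hh_zero]; ring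
    rw [h1] at hab
    have h2 : lam 0 * a 0 + ∑ j ∈ Finset.range n, lam (j + 1) * a (j + 1) =
        ∑ j ∈ Finset.range (n + 1), lam j * a j := by
      rw [Finset.sum_range_succ']
      ring
    have h3 : ∑ j ∈ Finset.range (n + 1), lam j * a j = cpDeg D := by
      rw [hdegS, hnm]
      refine Finset.sum_congr rfl fun j hj ↦ ?_
      simp only [ha]
      rw [mul_div_cancel₀ _ (hlam_pos j (by simp at hj; omega)).ne']
    unfold pieceVal
    linarith
  -- the function `f` and its piece data (projections of `cpPiecesOfData` reduce by `rfl`; we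
  -- restate the needed consequences with the local names `lam`, `h`, `n`)
  have hper : ∀ x, 0 < x → periodicExt p lam h n (p * x) = periodicExt p lam h n x :=
    fun x hx ↦ periodicExt_mul_p hp1 h0pos hx
  have hrat : IsCpRational p (periodicExt p lam h n) :=
    (cpPiecesOfData p hp1 lam h n h0pos hlam_lt hlast hh_mem hclos).isCpRational hper
  have hex : ∀ x, 0 < x → ∃ (k : ℤ) (y : ℝ), lam 0 ≤ y ∧ y < lam (n + 1) ∧
      x = (p : ℝ) ^ k * y ∧
        cpOrder (periodicExt p lam h n) x = cpOrder (periodicExt p lam h n) y :=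
    fun x hx ↦ (cpPiecesOfData p hp1 lam h n h0pos hlam_lt hlast hh_mem hclos).exists_cpOrder_eq
      hp1 hper hx
  have hpiece : ∀ y, lam 0 ≤ y → y < lam (n + 1) → ∃ j, j ≤ n ∧ lam j ≤ y ∧ y < lam (j + 1) :=
    fun y hy0 hy1 ↦
      (cpPiecesOfData p hp1 lam h n h0pos hlam_lt hlast hh_mem hclos).exists_piece_right hy0 hy1
  have hord_zero : cpOrder (periodicExt p lam h n) (lam 0) = lam 0 * (h 0 - p * h n) :=
    (cpPiecesOfData p hp1 lam h n h0pos hlam_lt hlast hh_mem hclos).cpOrder_lam_zero hp0 hper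
  have hord_succ : ∀ i, i + 1 ≤ n →
      cpOrder (periodicExt p lam h n) (lam (i + 1)) = lam (i + 1) * (h (i + 1) - h i) :=
    fun i hi ↦ (cpPiecesOfData p hp1 lam h n h0pos hlam_lt hlast hh_mem hclos).cpOrder_lam_succ hi
  have hord_Ioo : ∀ j, j ≤ n → ∀ y, lam j < y → y < lam (j + 1) →
      cpOrder (periodicExt p lam h n) y = 0 :=
    fun j hj y h1 h2 ↦
      (cpPiecesOfData p hp1 lam h n h0pos hlam_lt hlast hh_mem hclos).cpOrder_of_mem_Ioo hj h1 h2
  refine ⟨periodicExt p lam h n, hrat, fun x hx ↦ ?_⟩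
  obtain ⟨k, y, hy0, hy1, rfl, hord⟩ := hex x hx
  rw [hord, D.apply_zpow_mul hp0 (h0pos.trans_le hy0)]
  obtain ⟨j, hj, hy2, hy3⟩ := hpiece y hy0 hy1
  rcases hy2.eq_or_lt with hyeq | hylt
  · -- `y = λ_j` is a breakpoint
    rw [← hyeq]
    rcases j with _ | i
    · rw [hord_zero, hh_zero]
      simp only [ha]
      rw [mul_div_cancel₀ _ h0pos.ne']
    · rw [hord_succ i hj, hh_succ]
      simp only [ha]
      rw [mul_div_cancel₀ _ (hlam_pos (i + 1) (by omega)).ne']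
  · -- interior point: both sides vanish
    rw [hord_Ioo j hj y hylt hy3]
    refine hDzero y (h0pos.trans_le hy0) fun hmemS ↦ ?_
    obtain ⟨i, hi⟩ := he_surj _ hmemS
    obtain ⟨-, -, r3⟩ := fundRed_spec hp1 zero_lt_one (h0pos.trans_le hy0)
    rw [← hi, ← hlam_of_lt i i.2] at r3
    have hli0 : lam 0 ≤ lam i := seq_le_of_le hlam_lt (Nat.zero_le _) (by omega)
    have hli1 : lam i < p * lam 0 := by
      rw [← hlast]; exact seq_lt_of_lt hlam_lt (show (i : ℕ) < n + 1 by omega) le_rfl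
    obtain ⟨-, hyi⟩ := zpow_mul_eq_zpow_mul_iff hp1 h0pos hy0 (by rwa [← hlast]) hli0 hli1
      (k := 0) (k' := fundExp p 1 y) (by rw [zpow_zero, one_mul]; exact r3)
    have hji : j < i := by
      by_contra hc
      push Not at hc
      have := seq_le_of_le hlam_lt hc (by omega)
      linarith
    have hij : (i : ℕ) < j + 1 := by
      by_contra hc
      push Not at hc
      have := seq_le_of_le hlam_lt hc (by omega)
      linarith
    omega

/-! ### Theorem 5.6, surjectivity of `(deg, χ)`; Lemma 5.13 (ii) -/

/-- Values of a sum of divisors. [folklore] -/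
@[simp] theorem CpDivisor.add_apply {p : ℕ} (hp : p ≠ 0) (D E : CpDivisor p) (x : ℝ) :
    (D.add hp E).toFun x = D.toFun x + E.toFun x := rfl

/-- Values of the negated divisor. [folklore] -/
@[simp] theorem CpDivisor.neg_apply {p : ℕ} (D : CpDivisor p) (x : ℝ) :
    D.neg.toFun x = -D.toFun x := rfl

/-- Lifting a class `c ∈ ℤ/(p-1)ℤ` to a positive and to a negative integer ("let
`m ∈ {1, …, p-1}` be an integer congruent to `χ(D)` mod. `p - 1`"). [folklore] -/
theorem exists_int_cast_zmod_pred_eq {p : ℕ} (hp : 1 < p) (c : ZMod (p - 1)) :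
    (∃ M : ℤ, (M : ZMod (p - 1)) = c ∧ 0 < M) ∧ ∃ M : ℤ, (M : ZMod (p - 1)) = c ∧ M < 0 := by
  haveI : NeZero (p - 1) := ⟨Nat.sub_ne_zero_of_lt hp⟩
  have h1 : ((c.val : ℤ) : ZMod (p - 1)) = c := by rw [Int.cast_natCast, ZMod.natCast_zmod_val]
  have h2 : (((p - 1 : ℕ) : ℤ) : ZMod (p - 1)) = 0 := by rw [Int.cast_natCast, ZMod.natCast_self]
  have h3 := ZMod.val_lt c
  exact ⟨⟨c.val + (p - 1 : ℕ), by rw [Int.cast_add, h1, h2, add_zero], by omega⟩,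
    ⟨c.val - (p - 1 : ℕ), by rw [Int.cast_sub, h1, h2, sub_zero], by omega⟩⟩

/-- The point divisor `M · P_t` (`t > 0`, `M ∈ ℤ`): it takes only the values `tM` and `0`, has
degree `tM` and `χ = M` ("`deg(P_λ) = λ`. Moreover one has `χ(P_λ) = 1`").
[cite: ConnesConsani2017ScalingSite, Lemma 5.13 (ii) (proof)] -/
theorem exists_cpDivisor_point {p : ℕ} (hp : 1 < p) {t : ℝ} (ht : 0 < t) (M : ℤ) :
    ∃ D : CpDivisor p, (∀ x, D.toFun x = t * M ∨ D.toFun x = 0) ∧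
      cpDeg D = t * M ∧ cpChi D = (M : ZMod (p - 1)) := by
  classical
  have hp0 : 0 < p := zero_lt_one.trans hp
  obtain ⟨k, y, hy1, -, hty⟩ := exists_zpow_mul_mem_Ico hp zero_lt_one ht
  have hy : 0 < y := zero_lt_one.trans_le hy1
  have hval : t * M / y = (p : ℝ) ^ k * ((M : ℤ) : ℝ) := by
    rw [hty, mul_right_comm, mul_div_assoc, div_self hy.ne', mul_one]
  have hv : IsPFraction p (t * M / y) := by rw [hval]; exact (isPFraction_intCast p M).mul_zpow k
  refine ⟨CpDivisor.single p hp y (t * M) hy hv, fun x ↦ ?_, cpDeg_single hp hy hv, ?_⟩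
  · rw [CpDivisor.single_apply]
    split_ifs
    · exact Or.inl rfl
    · exact Or.inr rfl
  · rw [cpChi_single hp hy hv, hval, pFractionChi_zpow_mul hp0, pFractionChi_intCast hp0]

/-- **Theorem 5.6, surjectivity**: `(deg, χ) : Div(C_p) → ℝ × ℤ/(p-1)ℤ` is onto.
[cite: ConnesConsani2017ScalingSite, Thm. 5.6] -/
theorem exists_cpDivisor_cpDeg_eq_cpChi_eq {p : ℕ} (hp : p.Prime) (d : ℝ) (c : ZMod (p - 1)) :
    ∃ D : CpDivisor p, cpDeg D = d ∧ cpChi D = c := by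
  have hp1 := hp.one_lt
  have hp0 := hp.pos
  obtain ⟨⟨M, hMc, hM⟩, ⟨M', hMc', hM'⟩⟩ := exists_int_cast_zmod_pred_eq hp1 c
  have hMR : (0 : ℝ) < M := by exact_mod_cast hM
  have hMR' : (M' : ℝ) < 0 := by exact_mod_cast hM'
  rcases lt_trichotomy d 0 with hd | rfl | hd
  · obtain ⟨D, -, h1, h2⟩ := exists_cpDivisor_point hp1 (div_pos_of_neg_of_neg hd hMR') M'
    exact ⟨D, by rw [h1, div_mul_cancel₀ _ hMR'.ne], by rw [h2, hMc']⟩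
  · -- `d = 0`: `P_1` with value `M` plus `P_μ`, `μ = M/(p-1)`, with value `-M`
    -- (`-M/μ = -(p-1) ∈ H_p`, `χ(-(p-1)) = 0`)
    have hq : (0 : ℝ) < (p : ℝ) - 1 := by
      have : (1 : ℝ) < p := by exact_mod_cast hp1
      linarith
    have hμ : 0 < (M : ℝ) / ((p : ℝ) - 1) := div_pos hMR hq
    have hv1 : IsPFraction p ((M : ℝ) / 1) := by rw [div_one]; exact isPFraction_intCast p M
    have hval2 : -(M : ℝ) / ((M : ℝ) / ((p : ℝ) - 1)) = ((-((p - 1 : ℕ) : ℤ) : ℤ) : ℝ) := by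
      rw [div_div_eq_mul_div, neg_mul, neg_div, mul_div_cancel_left₀ _ hMR.ne', Int.cast_neg,
        Int.cast_natCast, Nat.cast_sub hp1.le, Nat.cast_one]
    have hv2 : IsPFraction p (-(M : ℝ) / ((M : ℝ) / ((p : ℝ) - 1))) := by
      rw [hval2]; exact isPFraction_intCast p _
    refine ⟨(CpDivisor.single p hp1 1 M zero_lt_one hv1).add hp0.ne'
        (CpDivisor.single p hp1 _ _ hμ hv2), ?_, ?_⟩
    · rw [cpDeg_add, cpDeg_single, cpDeg_single, add_neg_cancel]
    · rw [cpChi_add hp0, cpChi_single, cpChi_single, div_one, hval2, pFractionChi_intCast hp0,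
        pFractionChi_intCast hp0, hMc, Int.cast_neg, Int.cast_natCast, ZMod.natCast_self, neg_zero,
        add_zero]
  · obtain ⟨D, -, h1, h2⟩ := exists_cpDivisor_point hp1 (div_pos hd hMR) M
    exact ⟨D, by rw [h1, div_mul_cancel₀ _ hMR.ne'], by rw [h2, hMc]⟩

/-- **Theorem 5.6** (discharge of the named fact): `𝒫 = Ker(deg, χ)` and `(deg, χ)` is onto, so
that `DivCl(C_p) ≅ ℝ × ℤ/(p-1)ℤ`. [cite: ConnesConsani2017ScalingSite, Thm. 5.6] -/
theorem ConnesConsani2017_thm_5_6_holds : ConnesConsani2017_thm_5_6 := fun _p hp ↦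
  ⟨fun D ↦ ⟨fun h ↦ h.cpDeg_eq_zero_and_cpChi_eq_zero hp.one_lt,
    fun h ↦ D.isPrincipal_of_cpDeg_eq_zero_of_cpChi_eq_zero hp h.1 h.2⟩,
   exists_cpDivisor_cpDeg_eq_cpChi_eq hp⟩

/-- **Lemma 5.13 (ii)**: if `deg D > 0` then `H⁰(D) ≠ 0` ("`D' = D - mP_{λ/m}` fulfills
`deg(D') = 0` and `χ(D') = 0` and hence it is principal. Let `f` with `D' + (f) = 0`. One has
`D + (f) = mP_{λ/m} ≥ 0`"). [cite: ConnesConsani2017ScalingSite, Lemma 5.13 (ii)] -/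
theorem cpH0_nonempty_of_cpDeg_pos {p : ℕ} (hp : p.Prime) (D : CpDivisor p) (hd : 0 < cpDeg D) :
    (cpH0 D).Nonempty := by
  have hp1 := hp.one_lt
  have hp0 := hp.pos
  obtain ⟨⟨M, hMc, hM⟩, -⟩ := exists_int_cast_zmod_pred_eq hp1 (cpChi D)
  have hMR : (0 : ℝ) < M := by exact_mod_cast hM
  obtain ⟨E, hEval, hEdeg, hEchi⟩ := exists_cpDivisor_point hp1 (div_pos hd hMR) M
  rw [div_mul_cancel₀ _ hMR.ne'] at hEval hEdeg
  -- `D' = D - E` has `deg = 0`, `χ = 0`; we use `G = E - D = -D'` and `f` with `(f) = G`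
  have hGdeg : cpDeg (E.add hp0.ne' D.neg) = 0 := by
    rw [cpDeg_add, cpDeg_neg, hEdeg, add_neg_cancel]
  have hGchi : cpChi (E.add hp0.ne' D.neg) = 0 := by
    rw [cpChi_add hp0, cpChi_neg hp0, hEchi, hMc, add_neg_cancel]
  obtain ⟨f, hf, hfG⟩ :=
    (E.add hp0.ne' D.neg).isPrincipal_of_cpDeg_eq_zero_of_cpChi_eq_zero hp hGdeg hGchi
  refine ⟨f, hf, fun x hx ↦ ?_⟩
  have h := hfG x hx
  rw [CpDivisor.add_apply, CpDivisor.neg_apply] at h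
  rcases hEval x with h' | h' <;> linarith

end Construction

/-- **Lemma 5.13** (discharge of the named fact). [cite: ConnesConsani2017ScalingSite, Lemma 5.13] -/
theorem ConnesConsani2017_lemma_5_13_holds : ConnesConsani2017_lemma_5_13 := fun _p hp D ↦
  ⟨fun h ↦ cpH0_eq_empty_of_cpDeg_neg hp.one_lt h, cpH0_nonempty_of_cpDeg_pos hp D⟩

end Literature.NumberTheory.ConnesConsani

end
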